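import Literature.MathematicalPhysics.QuantumFieldTheory.Balaban1983to89.B9SectBL2GReadCodedQY
import Literature.MathematicalPhysics.QuantumFieldTheory.Balaban1983to89.B9SectBQLettersL2QY
import Literature.MathematicalPhysics.QuantumFieldTheory.Balaban1983to89.B9SectBGFramesSelQY
import Literature.MathematicalPhysics.QuantumFieldTheory.Balaban1983to89.B9SectBL2GFrameSelY

/-!
# `Balaban1983to89.B9SectBL2GFrameSelQY` — T. Bałaban, *Propagators for lattice gauge theories in a background field*, Commun. Math. Phys. **99** (1985)
# 389–434 [Balaban1985BackgroundPropagators], Thm 3.4 p. 400, Thm 3.3 p. 399, (3.46)–(3.47) p. 398, (3.77) p. 406: THE (3.46)∕(3.47) BOND-SECTOR FRAME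
# AND THE (3.77) READING AT A GENERIC AVERAGING PAIR `(𝔮, 𝔮s)` — `G[𝔮] := GAQY 𝔮 𝔮s par (GpY par)` (CASCADE-K piece «K2-G», stage C3; the
# `(𝔮, 𝔮s)`-edition of module S3 `B9SectBL2GFrameSelY` §§ L2G, Read377)

statement-level skeleton of published theorems with citation tags; proofs where landed; nothing here is a claim about the Yang–Mills mass gap

WHY THIS FILE (seat dag-n06-c gen 25; «⚑ K2-G SCOPE» stage M3; node00-def-Y RULING I.20106).  S3 builds `l2GFrame₈CodedOnSel` (the (3.46)∕(3.47) frame) and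
reads the (3.77) field of the G frame at the straight letter.  THIS FILE: `l2GFrame₈CodedOnSelQ` = S3's constructor VERBATIM on `gFrame₅CodedOnSelQ` with the
ℓ² letters `QbQC2 ∕ QsbQC2 ∕ F₂QC2 ∕ F₂sQC2` (`B9SectBQLettersL2QY`, law `q2_prod := qQC2_prod`), the readers `readGL2_GbQC_all ∕ writeGL2_GbQC`
(`B9SectBL2GReadCodedQY`), and the three `QY`-analytic ℓ² fields (`hQb2 ∕ hQsb2 ∕ hF₂2` ← `hasL2Majorant_QbC2 ∕ QsbC2 ∕ F₂C2 ∕ F₂sC2`) fed by the DISPLAYED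
LAWS `hQL2` (constant `κQ2`) and `hQL280` (constant `cF2`) of the fields' shapes; `read377L2_gFrame₅CodedOnSelQ` = S3's (3.77) reading verbatim (it reads the
site letters of the frame only).  `l2ReadingsQ_pairAt`, `l2Frame₂CodedOnSel` (G′ side) are S3's, USED unchanged.

HONEST SCOPE.  Re-threading bookkeeping; every field is S3's proof term at the generic letters or a displayed law; nothing of [B9] asserted beyond S3's displayed
hypotheses plus the ℓ² size laws (now hypotheses instead of the `QY` lemmas); COUNT-NEUTRAL; N06 NOT discharged; one finite lattice programme — nothing
continuum ∕ OS ∕ mass-gap ∕ Clay.  Cell `pub-ymgap` (HUMAN RULING D-0062), Track A node N06 [B9], CASCADE-K (№383) piece K2-G.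

RELATED IN THE TREE, NOT DUPLICATED: `B9SectBL2GFrameSelY` (S3), `B9SectBGFramesSelQY` (stage C), `B9SectBQLettersL2QY` ∕ `B9SectBL2GReadCodedQY` (stage M3
letters ∕ readers) — USED BY NAME; no existing module modified.
-/

noncomputable section

namespace Literature.MathematicalPhysics.QuantumFieldTheory.Balaban1983to89.B9SectBL2GFrameSelQY

open Literature.MathematicalPhysics.QuantumFieldTheory.Balaban1983to89.B9SectBParSelY
open Literature.MathematicalPhysics.QuantumFieldTheory.Balaban1983to89.B9SectBFramesSelY (gpFrame₂CodedOnSel cinvFrame₃CodedOnSel)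
open Literature.MathematicalPhysics.QuantumFieldTheory.Balaban1983to89.B9SectBL2GFrameSelY (l2ReadingsQ_pairAt l2Frame₂CodedOnSel)

variable {d ℓ : ℕ} {hd : 1 ≤ d + 1} {hL : Odd (ℓ + 1) ∧ 1 < ℓ + 1} {b₀ b₁ : ℝ} {Mstar : ℕ}
variable {𝔸 : Type} [NormedRing 𝔸] (P : B9SectBCodedClassR.RegExtraY d ℓ hd hL b₀ b₁ Mstar 𝔸) [NormedAlgebra ℂ 𝔸] [CompleteSpace 𝔸]

/-! ## L2G — the (3.46)∕(3.47) bond-sector frame at `G[𝔮]` -/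

section L2G


open Literature.MathematicalPhysics.QuantumFieldTheory.Balaban1983to89.B9SectBL2GFrameCodedV8YR hiding l2GFrame₈CodedOn stepL2Pos_KACU_frame₈_on
open Literature.MathematicalPhysics.QuantumFieldTheory.Balaban1983to89.B9SectBCodedClassR (RegExtraY bg9YC)
open Literature.MathematicalPhysics.QuantumFieldTheory.Balaban1983to89.B9SectBL2GFrameCodedV8Y hiding l2GFrame₈CodedOn stepL2Pos_KACU_frame₈_on
open B6Ineq2142KLevelV1 (β)
open B6KLevelCensusIndexV1 (KIdx kGeo)
open B6RandomWalk (Ineq261)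
open B6RandomWalkL2 (HasL2Majorant hasL2Majorant_mono)
open B9Thm34Ext (toB6)
open B9Ineq347 (ScaleTransfer)
open B9FromB6 (EBlock L2Block)
open B9PinMembersKLevelV1 (MemberY geo9Y bg9Y)
open B9Eq360DeltaPrimeAY (AfldY)
open B9SectBGpLettersY (GVal)
open B9SectBGpFrameCodedYR (codingYx)
open B9SectBGpFrameCodedY (CplxLettersY)
open B9SectBGpReadingsYR (KSC)
open B9SectBCodedCarrier (pullS)
open B9SectBCodedReadingsUR (KACU)
open B9SectBKerFrameCodedYR (CinvY)
open B9SectBStepWhole (StepL2Pos)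
open B9RWSumsReadsNbr (nbr)
open B9RWSums347DefiniteFacesWindow (scaleTransfer6_window_geo9Y)
open B9SectBGClassLettersY (Reg335PlaqY CplxLettersGY VarParBY)
open B9SectBGFrameCodedYRG (gFrame₅CodedOn)
open B9SectBGFrameCodedY (parB_contractive)
open B9SectBL2GFrameV8 (L2GFrame₈ stepL2Pos_of_l2GFrame₈)
open B9SectBL2GFrameCodedY (Read377L2 d261Y M261Y d261Y_spec card_nbr_mono l2Block_mono_const)
open B9SectBL2GCrossYR (readGL2_GbC_all)
open B9SectBL2GCrossY (cLGY cLGY_nonneg plaqLawY_of_reg335PlaqY)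
open B9SectBL2GReadCodedYR (writeGL2_GbC)
open B9SectBQLettersL2Y (QbC2 QsbC2 F₂C2 F₂sC2 qC2_prod qbC2_prod qsbC2_prod hasL2Majorant_QbC2 hasL2Majorant_QsbC2 hasL2Majorant_F₂C2 hasL2Majorant_F₂sC2)
open B9SectBQSizesL2Y (hasL2Majorant_abC)
open B9GeoLemma21KLevelV1 (geo9K_one_le_L geo9Y_len_pos)
open B9GeoNormsKLevelV1 (geo9K)
open Node00 (SiteY BlkY FBondY IBondY CfgY SiteParY BondParY GAQY GpY XY deltaAQY deltaPrimeAY)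
open Literature.MathematicalPhysics.QuantumFieldTheory.Balaban1983to89.B9SectBParSelY
open Literature.MathematicalPhysics.QuantumFieldTheory.Balaban1983to89.B9SectBFramesSelY (gpFrame₂CodedOnSel cinvFrame₃CodedOnSel)
open Literature.MathematicalPhysics.QuantumFieldTheory.Balaban1983to89.B9SectBGFramesSelY (gFrame₅CodedOnSel)

open Literature.MathematicalPhysics.QuantumFieldTheory.Balaban1983to89.B9SectBGWordDeltaAQY (GbQC QbQC QsbQC F₂QC F₂sQC)
open Literature.MathematicalPhysics.QuantumFieldTheory.Balaban1983to89.B9SectBQLettersL2QY (QbQC2 QsbQC2 F₂QC2 F₂sQC2 qQC2_prod qbQC2_prod qsbQC2_prod)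
open Literature.MathematicalPhysics.QuantumFieldTheory.Balaban1983to89.B9SectBGReadCodedQY (GbQC_eq_conj_bondOpCoordsRY)
open Literature.MathematicalPhysics.QuantumFieldTheory.Balaban1983to89.B9SectBL2GReadCodedQY (readGL2_GbQC_printed writeGL2_GbQC readGL2_GbQC_all)
open Literature.MathematicalPhysics.QuantumFieldTheory.Balaban1983to89.B9SectBGFramesSelQY (gFrame₅CodedOnSelQ)
open Literature.MathematicalPhysics.QuantumFieldTheory.Balaban1983to89.B6RandomWalk (HasMajorant)
open Literature.MathematicalPhysics.QuantumFieldTheory.Balaban1983to89.B9SectBGpLettersY (blkC GVal)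
open Literature.MathematicalPhysics.QuantumFieldTheory.Balaban1983to89.Node00 (FBondY IBondY CfgY SiteY SiteParY BondParY)
variable [NormOneClass 𝔸] [FiniteDimensional ℝ 𝔸] {J : Type} (f : J → MemberY d ℓ hd hL b₀ b₁ Mstar)
  [∀ x : MemberY d ℓ hd hL b₀ b₁ Mstar, Fintype (geo9Y x).Site]
  [instDS : ∀ x : MemberY d ℓ hd hL b₀ b₁ Mstar, DecidableEq (geo9Y x).Site] [instNE : ∀ x : MemberY d ℓ hd hL b₀ b₁ Mstar, Nonempty (geo9Y x).Site]
  (c35 : ℝ) (G : Subgroup 𝔸ˣ)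
  (𝔮 : ∀ j : J, CfgY 𝔸 (f j).toKIdx → ((FBondY (f j).toKIdx → 𝔸) →ₗ[ℂ] (IBondY (f j).toKIdx → 𝔸)))
  (𝔮s : ∀ j : J, CfgY 𝔸 (f j).toKIdx → ((IBondY (f j).toKIdx → 𝔸) →ₗ[ℂ] (FBondY (f j).toKIdx → 𝔸)))
  (par : ∀ j : J, SiteParY 𝔸 (f j).toKIdx) (parB : ∀ j : J, BondParY 𝔸 (f j).toKIdx)
  {ι : Type} [Fintype ι] [DecidableEq ι] (b : Module.Basis ι ℝ 𝔸) (ιB : ∀ j : J, BlkY (f j).toKIdx → IBondY (f j).toKIdx)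
  (C37 C38 : ∀ j : J, ℝ → CfgY 𝔸 (f j).toKIdx → AfldY 𝔸 (f j).toKIdx → Prop)

set_option maxHeartbeats 400000 in
/-- ★★★ **THE (3.46)∕(3.47) BOND-SECTOR FRAME `L2GFrame₈` OVER THE CODED CARRIERS OF A SUBFAMILY AT A GENERIC AVERAGING PAIR `(𝔮, 𝔮s)`** — S3's
`l2GFrame₈CodedOnSel` VERBATIM on `gFrame₅CodedOnSelQ`: ℓ² letters `QbQC2 ∕ QsbQC2 ∕ F₂QC2 ∕ F₂sQC2` (law `q2_prod := qQC2_prod`), readers `readGL2_GbQC_all ∕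
writeGL2_GbQC`, the ℓ² size fields fed by the DISPLAYED LAWS `hQL2 ∕ hQL280`, the (3.77) field displayed as `h377` (discharged by `read377L2_gFrame₅CodedOnSelQ`).
[cite: Balaban1985BackgroundPropagators, Thm 3.4 p.400, Thm 3.3 p.399, (3.46)–(3.47) p.398, (3.77) p.406, (3.82)–(3.86) p.407, (3.35)–(3.37) p.396; Balaban1984PropagatorsII, Prop. 2.6 (2.140) p.247, Lemma 2.1 p.234] -/
noncomputable def l2GFrame₈CodedOnSelQ (hι : ∀ (j : J) (s : BlkY (f j).toKIdx), β (f j).toKIdx.hN (f j).toKIdx.D (f j).toKIdx.hk (ιB j s) = s)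
    (hG1 : ∀ u : 𝔸ˣ, u ∈ G → ‖(u : 𝔸)‖ ≤ 1)
    (M₂ : ℝ) (hM₂ : 0 ≤ M₂) (hrepr : ∀ (v : 𝔸) (j : ι), |b.repr v j| ≤ M₂ * ‖v‖) (hcR : 0 < M₂ * ∑ j, ‖b j‖)
    (Cq : ℝ) (hCq : 0 ≤ Cq) (hC37 : ∀ j β' U a, C37 j β' U a → GVal G (f j).toKIdx U ∧ CplxLettersY G (f j) (par j) (ιB j) Cq β' U a)
    (MInv aInv aW : ℝ) (hMInv : 0 < MInv) (haInv : 0 < aInv) (haW : 0 < aW)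
    (hparG : ∀ j (α₀ : ℝ) (U : CfgY 𝔸 (f j).toKIdx), MInv ≤ (geo9Y (f j)).M → 0 < α₀ → (geo9Y (f j)).M * α₀ ≤ aInv →
      (bg9YC 𝔸 G P (f j)).Reg335 c35 α₀ U → ∀ z w, par j U z w ∈ G)
    (hparC : ∀ j β' U a, C37 j β' U a → ∀ z w, par j U z w ∈ G)
    (hunitG : ∀ j (α₀ : ℝ) (U : CfgY 𝔸 (f j).toKIdx), MInv ≤ (geo9Y (f j)).M → 0 < α₀ → (geo9Y (f j)).M * α₀ ≤ aInv →
      (bg9YC 𝔸 G P (f j)).Reg335 c35 α₀ U → IsUnit (deltaPrimeAY (f j).toKIdx (par j) U))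
    (hunitXG : ∀ j (α₀ : ℝ) (U : CfgY 𝔸 (f j).toKIdx), MInv ≤ (geo9Y (f j)).M → 0 < α₀ → (geo9Y (f j)).M * α₀ ≤ aInv →
      (bg9YC 𝔸 G P (f j)).Reg335 c35 α₀ U → IsUnit (XY (f j).toKIdx (par j) (GpY (f j).toKIdx (par j)) U))
    (hsym : ∀ j (U : CfgY 𝔸 (f j).toKIdx) (z w : SiteY (f j).toKIdx), par j U z w = (par j U w z)⁻¹)
    (hunitA : ∀ j (α₀ : ℝ) (U : CfgY 𝔸 (f j).toKIdx), MInv ≤ (geo9Y (f j)).M → 0 < α₀ → (geo9Y (f j)).M * α₀ ≤ aInv →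
      (bg9YC 𝔸 G P (f j)).Reg335 c35 α₀ U → IsUnit (deltaAQY (f j).toKIdx (𝔮 j) (𝔮s j) (par j) (GpY (f j).toKIdx (par j)) U))
    (hb₁ : 0 ≤ b₁)
    (C₀ : ℝ) (hC₀ : 0 ≤ C₀)
    (hreg335P : ∀ j (α₀ : ℝ) (U : CfgY 𝔸 (f j).toKIdx), MInv ≤ (geo9Y (f j)).M → 0 < α₀ → (geo9Y (f j)).M * α₀ ≤ aInv →
      (bg9YC 𝔸 G P (f j)).Reg335 c35 α₀ U → Reg335PlaqY G (f j) (ιB j) C₀ U)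
    (hC37G : ∀ j β' U a, C37 j β' U a → CplxLettersGY G (f j) (ιB j) β' U a)
    -- [K2-G] the DISPLAYED LAWS of the averaging pair `(𝔮, 𝔮s)`, GUARDED like `hparG ∕ hunitA`: (3.15) block majorants of `𝔮 ∕ 𝔮s` at (3.35)-regular bases above the thresholds, (3.80) variations at (3.37) pairs
    (κQ : ℝ) (hκQ : 0 ≤ κQ)
    (hQ15 : ∀ j (α₀ : ℝ) (U : CfgY 𝔸 (f j).toKIdx) (δ : ℝ), MInv ≤ (geo9Y (f j)).M → 0 < α₀ → (geo9Y (f j)).M * α₀ ≤ aInv →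
      (bg9YC 𝔸 G P (f j)).Reg335 c35 α₀ U → 0 < δ → δ ≤ 1 →
      HasMajorant (g := toB6 (geo9Y (f j)) 0 True) (fun q : (Fin (d + 1) × SiteY (f j).toKIdx) × ι => blkC (f j).toKIdx (ιB j) q.1.2)
          (QbQC (f j).toKIdx (𝔮 j) b (.base U)) (fun a a' => κQ * Real.exp (-(δ * (geo9Y (f j)).dist a a'))) ∧
        HasMajorant (g := toB6 (geo9Y (f j)) 0 True) (fun q : (Fin (d + 1) × SiteY (f j).toKIdx) × ι => blkC (f j).toKIdx (ιB j) q.1.2)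
          (QsbQC (f j).toKIdx (𝔮s j) b (.base U)) (fun a a' => κQ * Real.exp (-(δ * (geo9Y (f j)).dist a a'))))
    (cF : ℝ) (hcF : 0 ≤ cF)
    (hQ80 : ∀ j (β' : ℝ) (U : CfgY 𝔸 (f j).toKIdx) (a : AfldY 𝔸 (f j).toKIdx), 0 < β' → C37 j β' U a → ∀ δ : ℝ, 0 < δ → δ ≤ 1 →
      HasMajorant (g := toB6 (geo9Y (f j)) 0 True) (fun q : (Fin (d + 1) × SiteY (f j).toKIdx) × ι => blkC (f j).toKIdx (ιB j) q.1.2)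
          (F₂QC (f j).toKIdx (𝔮 j) b (.base U) (.mult a)) (fun a₁ a₂ => cF * β' * Real.exp (-(δ * (geo9Y (f j)).dist a₁ a₂))) ∧
        HasMajorant (g := toB6 (geo9Y (f j)) 0 True) (fun q : (Fin (d + 1) × SiteY (f j).toKIdx) × ι => blkC (f j).toKIdx (ιB j) q.1.2)
          (F₂sQC (f j).toKIdx (𝔮s j) b (.base U) (.mult a)) (fun a₁ a₂ => cF * β' * Real.exp (-(δ * (geo9Y (f j)).dist a₁ a₂))))
    -- [K2-G] the DISPLAYED block-ℓ² LAWS of the pair ((3.15) ∕ (3.80) in `ℓ²`; at `QY parB`: `B9SectBQLettersL2Y.hasL2Majorant_QbC2 ∕ QsbC2 ∕ F₂C2 ∕ F₂sC2`)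
    (κQ2 : ℝ) (hκQ2 : 0 ≤ κQ2)
    (hQL2 : ∀ j (α₀ : ℝ) (U : CfgY 𝔸 (f j).toKIdx) (δ : ℝ), MInv ≤ (geo9Y (f j)).M → 0 < α₀ → (geo9Y (f j)).M * α₀ ≤ aInv →
      (bg9YC 𝔸 G P (f j)).Reg335 c35 α₀ U → 0 < δ → δ ≤ 1 →
      HasL2Majorant (g := toB6 (geo9Y (f j)) 0 True) (fun q : (Fin (d + 1) × SiteY (f j).toKIdx) × ι => blkC (f j).toKIdx (ιB j) q.1.2)
          (QbQC2 (f j).toKIdx (𝔮 j) b (.base U)) (fun a a' => κQ2 * Real.exp (-(δ * (geo9Y (f j)).dist a a'))) ∧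
        HasL2Majorant (g := toB6 (geo9Y (f j)) 0 True) (fun q : (Fin (d + 1) × SiteY (f j).toKIdx) × ι => blkC (f j).toKIdx (ιB j) q.1.2)
          (QsbQC2 (f j).toKIdx (𝔮s j) b (.base U)) (fun a a' => κQ2 * Real.exp (-(δ * (geo9Y (f j)).dist a a'))))
    (cF2 : ℝ) (hcF2 : 0 ≤ cF2)
    (hQL280 : ∀ j (β' : ℝ) (U : CfgY 𝔸 (f j).toKIdx) (a : AfldY 𝔸 (f j).toKIdx), 0 < β' → C37 j β' U a → ∀ δ : ℝ, 0 < δ → δ ≤ 1 →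
      HasL2Majorant (g := toB6 (geo9Y (f j)) 0 True) (fun q : (Fin (d + 1) × SiteY (f j).toKIdx) × ι => blkC (f j).toKIdx (ιB j) q.1.2)
          (F₂QC2 (f j).toKIdx (𝔮 j) b (.base U) (.mult a)) (fun a₁ a₂ => cF2 * β' * Real.exp (-(δ * (geo9Y (f j)).dist a₁ a₂))) ∧
        HasL2Majorant (g := toB6 (geo9Y (f j)) 0 True) (fun q : (Fin (d + 1) × SiteY (f j).toKIdx) × ι => blkC (f j).toKIdx (ιB j) q.1.2)
          (F₂sQC2 (f j).toKIdx (𝔮s j) b (.base U) (.mult a)) (fun a₁ a₂ => cF2 * β' * Real.exp (-(δ * (geo9Y (f j)).dist a₁ a₂))))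
    (hMd : 2 * ((d : ℝ) + 1) < MInv) (mN : ℕ) (hnbr : ∀ (j : J) (y' : IBondY (f j).toKIdx), (nbr (geo9Y (f j)) (2 * ((d : ℝ) + 1)) y').card ≤ mN)
    (h377 : Read377L2 (gFrame₅CodedOnSelQ P f c35 G 𝔮 𝔮s par parB b ιB C37 C38 hι hG1 M₂ hM₂ hrepr hcR Cq hCq hC37 MInv aInv aW hMInv haInv haW hparG hparC hunitG hunitXG hsym hunitA
        hb₁ C₀ hC₀ hreg335P hC37G κQ hκQ hQ15 cF hcF hQ80 hMd mN hnbr)) :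
    L2GFrame₈ c35 (fun j => geo9Y (f j)) (fun j => (codingYx P G (f j) (C37 j) (C38 j)).bg) (fun j => KSC P G (f j) (par j) (C37 j) (C38 j)) b (Fin (d + 1))
      (fun j => SiteY (f j).toKIdx) (fun j => BlkY (f j).toKIdx × ι)
      (fun j => KACU P G (f j) (GAQY (f j).toKIdx (𝔮 j) (𝔮s j) (par j) (GpY (f j).toKIdx (par j))) (parB j) (C37 j) (C38 j))
      (fun j => pullS (codingYx P G (f j) (C37 j) (C38 j)) (CinvY P f G par j)) :=
  { gFrame₅CodedOnSelQ P f c35 G 𝔮 𝔮s par parB b ιB C37 C38 hι hG1 M₂ hM₂ hrepr hcR Cq hCq hC37 MInv aInv aW hMInv haInv haW hparG hparC hunitG hunitXG hsym hunitA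
        hb₁ C₀ hC₀ hreg335P hC37G κQ hκQ hQ15 cF hcF hQ80 hMd mN hnbr with
    cLG := fun δ => cLGY (2 * C₀) M₂ (∑ j, ‖b j‖) (Real.sqrt (Fintype.card ι)) d (d261Y (d := d) (ℓ := ℓ) (hd := hd) (hL := hL) (b₀ := b₀) (b₁ := b₁) (Mstar := Mstar) δ) δ (((ℓ : ℝ) + 1) ^ 4)
    κQb2 := κQ2
    cFb2 := cF2
    abar2 := b₁
    wLG := fun B δ => (mN : ℝ) * (Real.sqrt (Fintype.card ι) * M₂ * ∑ j, ‖b j‖) * (((ℓ + 1 : ℕ) : ℝ)) ^ 2 * Real.exp δ * B + 1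
    wLGδ := fun δ => δ
    rLG := fun δ => δ / 2
    ML2 := fun δ => max (M261Y (d := d) (ℓ := ℓ) (hd := hd) (hL := hL) (b₀ := b₀) (b₁ := b₁) (Mstar := Mstar) δ) (4 * Real.log ((ℓ : ℝ) + 1) / (δ / 12))
    cLG_pos := fun δ hδ => by
      -- `cLGY = g_X²·g_I·(s_ι M₂ S_b)`, `g ≥ 1`, `s_ι M₂ S_b > 0`
      have hSb : 0 < ∑ j, ‖b j‖ := by
        rcases (mul_pos_iff.1 hcR) with ⟨-, h⟩ | ⟨h1, -⟩
        · exact h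
        · exact absurd h1 (not_lt.2 hM₂)
      have hne : Nonempty ι := by
        by_contra hι'
        rw [not_nonempty_iff] at hι'
        have : ∑ j, ‖b j‖ = 0 := Finset.sum_eq_zero fun j _ => (IsEmpty.false j).elim
        linarith
      have hcard : (0 : ℝ) < Fintype.card ι := by exact_mod_cast Fintype.card_pos
      have hM₂' : 0 < M₂ := by
        rcases (mul_pos_iff.1 hcR) with ⟨h, -⟩ | ⟨-, h2⟩
        · exact h
        · exact absurd h2 (not_lt.2 hSb.le)
      have hc1 := B6RandomWalk.c1_nonneg (d261Y (d := d) (ℓ := ℓ) (hd := hd) (hL := hL) (b₀ := b₀) (b₁ := b₁) (Mstar := Mstar) δ) δ (1 / 12)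
      unfold cLGY
      have hs : 0 < Real.sqrt (Fintype.card ι) * M₂ * ∑ j, ‖b j‖ := by positivity
      have h1 : (1 : ℝ) ≤ (1 + ((1 : ℝ) ^ 2 * M₂ * (∑ j, ‖b j‖) * Real.sqrt (Fintype.card ι) * Real.exp (δ * (2 * ((d : ℝ) + 1)))) *
          (((ℓ : ℝ) + 1) ^ 4) * B6.c1 (d261Y (d := d) (ℓ := ℓ) (hd := hd) (hL := hL) (b₀ := b₀) (b₁ := b₁) (Mstar := Mstar) δ) δ (1 / 12)) ^ 2 :=
        one_le_pow₀ (le_add_of_nonneg_right (by positivity))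
      have h2 : (1 : ℝ) ≤ 1 + B6.c1 (d261Y (d := d) (ℓ := ℓ) (hd := hd) (hL := hL) (b₀ := b₀) (b₁ := b₁) (Mstar := Mstar) δ) δ (1 / 12) * M₂ * (∑ j, ‖b j‖) * Real.sqrt (Fintype.card ι) *
          ((1 : ℝ) ^ 2 * Real.exp (δ * (2 * ((d : ℝ) + 1))) * ((ℓ : ℝ) + 1) ^ 4 +
            (1 : ℝ) ^ 4 * (2 * C₀) * (((ℓ : ℝ) + 1) ^ 4 * Real.exp (1 / 12 * δ * (2 * ((d : ℝ) + 1)))) *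
              Real.exp (δ * (2 * (2 * ((d : ℝ) + 1)))) * ((ℓ : ℝ) + 1) ^ 4) :=
        le_add_of_nonneg_right (by positivity)
      have := mul_le_mul h1 h2 zero_le_one (zero_le_one.trans h1)
      nlinarith
    rLG_pos := fun δ hδ => by positivity
    rLG_le := fun δ hδ => by linarith
    κQb2_nonneg := hκQ2
    cFb2_nonneg := hcF2
    abar2_nonneg := hb₁
    wLG_pos := fun B δ hB _ => by positivity
    wLGδ_pos := fun δ hδ => hδ
    Qb2 := fun j c => QbQC2 (f j).toKIdx (𝔮 j) b c
    Qsb2 := fun j c => QsbQC2 (f j).toKIdx (𝔮s j) b c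
    F₂2 := fun j c c' => F₂QC2 (f j).toKIdx (𝔮 j) b c c'
    F₂s2 := fun j c c' => F₂sQC2 (f j).toKIdx (𝔮s j) b c c'
    q2_prod := fun j c => qQC2_prod (f j).toKIdx (𝔮 j) (𝔮s j) b c
    qb2_mul := fun j α₁ c c' hα₁ h37 => by
      obtain ⟨U, a, rfl, rfl, -⟩ := (codingYx P G (f j) (C37 j) (C38 j)).exists_of_bg_Cplx337 h37
      exact ⟨qbQC2_prod (f j).toKIdx (𝔮 j) b U a, qsbQC2_prod (f j).toKIdx (𝔮s j) b U a⟩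
    hQb2 := fun j α₀ c δ hM hα₀ hMa hreg hδ hδc => by
      obtain ⟨U, rfl, hU⟩ := (codingYx P G (f j) (C37 j) (C38 j)).exists_of_bg_Reg335 hreg
      exact (hQL2 j α₀ U δ hM hα₀ hMa hU hδ hδc).1
    hQsb2 := fun j α₀ c δ hM hα₀ hMa hreg hδ hδc => by
      obtain ⟨U, rfl, hU⟩ := (codingYx P G (f j) (C37 j) (C38 j)).exists_of_bg_Reg335 hreg
      exact (hQL2 j α₀ U δ hM hα₀ hMa hU hδ hδc).2
    hF₂2 := fun j α₁ c c' hα₁ h37 δ hδ hδc => by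
      obtain ⟨U, a, rfl, rfl, hC⟩ := (codingYx P G (f j) (C37 j) (C38 j)).exists_of_bg_Cplx337 h37
      exact hQL280 j α₁ U a hα₁ hC δ hδ hδc
    ha2 := fun j => by
      letI : Fintype (geo9K (f j).toKIdx).Site := ‹∀ x : MemberY d ℓ hd hL b₀ b₁ Mstar, Fintype (geo9Y x).Site› (f j)
      letI : DecidableEq (geo9K (f j).toKIdx).Site := instDS (f j)
      exact hasL2Majorant_abC (Rr := 0) (Hp := True) (f j).toKIdx b (ιB j) (hι j) hb₁
    readGL2 := fun j α₀ c B₀ δ hM hML hα₀ hMa hreg hB₀ hδ hL2 => by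
      letI : Fintype (B9GeoNormsKLevelV1.geo9K (f j).toKIdx).Site := ‹∀ x : MemberY d ℓ hd hL b₀ b₁ Mstar, Fintype (geo9Y x).Site› (f j)
      obtain ⟨U, rfl, hU⟩ := (codingYx P G (f j) (C37 j) (C38 j)).exists_of_bg_Reg335 hreg
      have hM261 : M261Y (d := d) (ℓ := ℓ) (hd := hd) (hL := hL) (b₀ := b₀) (b₁ := b₁) (Mstar := Mstar) δ ≤ (geo9Y (f j)).M := le_trans (le_max_left _ _) hML
      have hMST : 4 * Real.log ((ℓ : ℝ) + 1) / (δ / 12) ≤ (geo9Y (f j)).M := le_trans (le_max_right _ _) hML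
      have h261 := d261Y_spec (f j) hδ (by norm_num : (9 : ℝ) / 5000 ≤ 1 / 12) (by norm_num) hM261
      have hκlo : 0 < δ / 12 := by positivity
      obtain ⟨hT1, -, -, hT2i, -, -⟩ := scaleTransfer6_window_geo9Y hκlo (f j) (δ := δ) (α := 1 / 12) (by linarith) hMST
      have hTi2 : ScaleTransfer (geo9Y (f j)) δ (1 / 12) (((ℓ : ℝ) + 1) ^ 4) (fun a => ((geo9Y (f j)).len a)⁻¹ ^ 2) := by
        have e : (fun a => ((geo9Y (f j)).len a)⁻¹ ^ 2) = (fun a => ((geo9Y (f j)).len a ^ 2)⁻¹) := funext fun a => by rw [inv_pow]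
        rw [e]; exact hT2i
      have hΛ : (1 : ℝ) ≤ ((ℓ : ℝ) + 1) ^ 4 := one_le_pow₀ (by have : (0 : ℝ) ≤ ℓ := Nat.cast_nonneg ℓ; linarith)
      have hplaq := plaqLawY_of_reg335PlaqY G (f j) (ιB j) hG1 hU.1.1 hC₀ (hreg335P j α₀ U hM hα₀ hMa hU)
      have hR : InRegY G (f j).toKIdx (par j) U := ⟨hU.1.1, hparG j α₀ U hM hα₀ hMa hU⟩
      dsimp only [gFrame₅CodedOnSelQ, cinvFrame₃CodedOnSel, gpFrame₂CodedOnSel]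
      erw [parSelC_base_of_inRegY G (f j).toKIdx (par j) hR]
      exact readGL2_GbQC_all P G (f j) (𝔮 j) (𝔮s j) (par j) (parB j) b (ιB j) (C37 j) (C38 j) (hι j) hG1 hM₂ hrepr hδ h261 hΛ hT1 hTi2 (by positivity) hU.1.1 hplaq
        hB₀.le hL2
    writeGL2 := fun j α₀ c c' α₁ B δ hM hα₀ hMa hreg hα₁ haW' h37 hB hδ h0 h1 h2 h3 h4 h5 => by
      letI : Fintype (B9GeoNormsKLevelV1.geo9K (f j).toKIdx).Site := ‹∀ x : MemberY d ℓ hd hL b₀ b₁ Mstar, Fintype (geo9Y x).Site› (f j)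
      obtain ⟨U, a, rfl, rfl, hC⟩ := (codingYx P G (f j) (C37 j) (C38 j)).exists_of_bg_Cplx337 h37
      have hUG := (hC37 j α₁ U a hC).1
      have hR : InRegY G (f j).toKIdx (par j) U := ⟨hUG, hparC j α₁ U a hC⟩
      dsimp only [gFrame₅CodedOnSelQ, cinvFrame₃CodedOnSel, gpFrame₂CodedOnSel] at h0 h1 h2 h3 h4 h5
      erw [parSelC_base_of_inRegY G (f j).toKIdx (par j) hR] at h0 h1 h2 h3 h4 h5
      have hnbr1 : ∀ y : IBondY (f j).toKIdx, (nbr (geo9Y (f j)) 1 y).card ≤ mN := fun y =>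
        (card_nbr_mono (f j) (by have : (0 : ℝ) ≤ d := Nat.cast_nonneg d; linarith) y).trans (hnbr j y)
      have hw := writeGL2_GbQC P (Rr := 0) (Hp := True) G (f j) (𝔮 j) (𝔮s j) (par j) (parB j) b (ιB j) (C37 j) (C38 j) (hι j) hM₂ hrepr hnbr1 U hUG a hB hδ.le
        h0 (fun ν => h1 (Sum.inl ν)) (fun ν => h2 (Sum.inr ν)) (fun ν μ => h4 (Sum.inl ν) (Sum.inr μ)) (fun ν μ => h3 (Sum.inl ν) (Sum.inl μ))
        (fun ν μ => h5 (Sum.inr ν) (Sum.inr μ))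
      exact l2Block_mono_const (f j) _ hw (by linarith)
    read377 := fun B₀ δ₀ B₁ δ₁ hB₀ hδ₀ hB₁ hδ₁ => h377 B₀ δ₀ B₁ δ₁ hB₀ hδ₀ hB₁ hδ₁ }

end L2G

/-! ## Read377 — the (3.77) field of the G frame at `G[𝔮]`: the site-side reading verbatim -/

section Read377


open Literature.MathematicalPhysics.QuantumFieldTheory.Balaban1983to89.B9SectBL2GRead377YR hiding read377L2_gFrame₅CodedOn
open Literature.MathematicalPhysics.QuantumFieldTheory.Balaban1983to89.B9SectBCodedClassR (RegExtraY bg9YC)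
open Literature.MathematicalPhysics.QuantumFieldTheory.Balaban1983to89.B9SectBL2GRead377Y hiding l2Block_record_of_KSC_base read377L2_gFrame₅CodedOn
open B6Ineq2142KLevelV1 (β)
open B6KLevelCensusIndexV1 (KIdx kGeo)
open B6RandomWalk (HasMajorant BlockSupp hasMajorant_mono Ineq261 blockPiece)
open B6RandomWalkL2 (HasL2Majorant hasL2Majorant_mono l2n l2n_nonneg l2n_sq abs_apply_le_l2n)
open B6RandomWalkL2Hom (HasL2MajorantHom hasL2MajorantHom_mono hasL2MajorantHom_add)
open B6Ineq268MultiLevelBox (W W_eq W_pos)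
open B9Thm34Ext (toB6)
open B9Ineq347 (ScaleTransfer)
open B9FromB6 (EBlock L2Block pref4_nonneg pref6_nonneg)
open B9PinMembersKLevelV1 (MemberY geo9Y bg9Y)
open B9Eq360DeltaPrimeAY (AfldY)
open B9Eq352DivFormLetters (conj)
open B9Eq352GradLetters (diffLetter)
open B9Eq360VprimeLetters (vPrimeConc)
open B9SectBGpLettersY (decY decY_base GVal blkC coordC GopC norm_le_one_and_inv_of_mem)
open B9SectBGpFrameCodedYR (codingYx)
open B9SectBGpFrameCodedY (CplxLettersY)
open B9SectBGpReadingsYR (KSC)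
open B9SectBGpReadingsY (etaS_eq_eta len_label)
open B9SectBCodedCarrier (CCfg pullS)
open B9SectBCodedReadingsUR (KACU)
open B9SectBKerFrameCodedYR (CinvY)
open B9SectBKerFrameCodedY (VarParY varParY_of_cplxLettersY len_ιB)
open B9SectBKerLettersY (QcC QcsC CopC FcC FcsC qcC_prod qcsC_prod)
open B9SectBKerLettersL2Y (wcY wsY wcY_nonneg wsY_nonneg wsY_mul_wcY hasL2MajorantHom_QcC hasL2MajorantHom_QcsC hasL2MajorantHom_FcC hasL2MajorantHom_FcsC)
open B9SectBGFrameCodedYRG (gFrame₅CodedOn)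
open B9SectBL2GFrameCodedY (Read377L2 d261Y M261Y d261Y_spec)
open B9SectBL2DictionaryYR (KSC₃ l2Frame₂CodedOn readL2_KSC₃ readL2_two_KSC₃ eBlock_KSC₃_iff)
open B9SectBL2SecondOrderYR (l2Block_KSC₃_base_of_record)
open B9SectBL2SecondOrderY (cross2ConstL2 cross2ConstL2_nonneg)
open B9SectBL2TransferInY (crossConstL2 crossConstL2_nonneg)
open B9SectBCodedChainL2 (l2Block_weaken)
open B9SectBL2GCrossY (plaqLawY_of_reg335PlaqY)
open B9SectBGClassLettersY (Reg335PlaqY CplxLettersGY VarParBY)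
open B9SectBL2StepAtLettersV2 (cVL2_le_one l2entries_ext_of_l2Frame₂)
open B9SectBL2StepAtLettersV2Right (rateR rateR_pos l2rightEntries_ext_of_l2Frame₂)
open B9SectBL2GStepAtLettersV3 (kappa377_le_one)
open B9Thm34SectBUniformR1 (thm34_Gp_uniform)
open B9Thm34InvBlk (thm34_Cinv_uniform_blk)
open B9Ineq363L2 (cVL2 cVL2_nonneg ineq363_l2_vPrime eq365_of_inverse hasL2Majorant_rate_mono)
open B9Ineq363L2Right (hasL2Majorant_gp_vPrime eq365_first_of_inverse)
open B9Ineq377POne (kappa377 kappa377_nonneg)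
open B9Ineq368PPrime (kappa349)
open B9Ineq368L2F (kappa368F)
open B9Thm34GL2Entries (pOneConc)
open B9Ineq349L2ReadingsP (ineq349_l2Hom_of_readingsP)
open B9Ineq368L2FP (ineq368_l2_FP)
open B9Ineq377L2Hom (ineq377_l2_concreteE)
open B9RWSumsReadsNbr (nbr)
open B9RWSums347DefiniteFacesWindow (scaleTransfer6_window_geo9Y)
open B9GeoLemma21KLevelV1 (geo9K_one_le_L geo9Y_len_pos geo9K_eta_pos)
open B9GeoNormsKLevelV1 (geo9K geo9K_dist_nonneg)
open Node00 (SiteY BlkY IBondY CfgY SiteParY BondParY GAQY GpY XY deltaAQY deltaPrimeAY kernelFamilyS etaS)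
open Literature.MathematicalPhysics.QuantumFieldTheory.Balaban1983to89.B9SectBParSelY
open Literature.MathematicalPhysics.QuantumFieldTheory.Balaban1983to89.B9SectBFramesSelY (gpFrame₂CodedOnSel cinvFrame₃CodedOnSel)
open Literature.MathematicalPhysics.QuantumFieldTheory.Balaban1983to89.B9SectBGFramesSelY (gFrame₅CodedOnSel)

open Literature.MathematicalPhysics.QuantumFieldTheory.Balaban1983to89.B9SectBGWordDeltaAQY (GbQC QbQC QsbQC F₂QC F₂sQC)
open Literature.MathematicalPhysics.QuantumFieldTheory.Balaban1983to89.B9SectBQLettersL2QY (QbQC2 QsbQC2 F₂QC2 F₂sQC2 qQC2_prod qbQC2_prod qsbQC2_prod)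
open Literature.MathematicalPhysics.QuantumFieldTheory.Balaban1983to89.B9SectBGReadCodedQY (GbQC_eq_conj_bondOpCoordsRY)
open Literature.MathematicalPhysics.QuantumFieldTheory.Balaban1983to89.B9SectBL2GReadCodedQY (readGL2_GbQC_printed writeGL2_GbQC readGL2_GbQC_all)
open Literature.MathematicalPhysics.QuantumFieldTheory.Balaban1983to89.B9SectBGFramesSelQY (gFrame₅CodedOnSelQ)
open Literature.MathematicalPhysics.QuantumFieldTheory.Balaban1983to89.B6RandomWalk (HasMajorant)
open Literature.MathematicalPhysics.QuantumFieldTheory.Balaban1983to89.B9SectBGpLettersY (blkC GVal)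
open Literature.MathematicalPhysics.QuantumFieldTheory.Balaban1983to89.Node00 (FBondY IBondY CfgY SiteY SiteParY BondParY)
variable [NormOneClass 𝔸] [FiniteDimensional ℝ 𝔸] {J : Type} (f : J → MemberY d ℓ hd hL b₀ b₁ Mstar)
  [∀ x : MemberY d ℓ hd hL b₀ b₁ Mstar, Fintype (geo9Y x).Site]
  [instDS : ∀ x : MemberY d ℓ hd hL b₀ b₁ Mstar, DecidableEq (geo9Y x).Site] [instNE : ∀ x : MemberY d ℓ hd hL b₀ b₁ Mstar, Nonempty (geo9Y x).Site]
  (c35 : ℝ) (G : Subgroup 𝔸ˣ)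
  (𝔮 : ∀ j : J, CfgY 𝔸 (f j).toKIdx → ((FBondY (f j).toKIdx → 𝔸) →ₗ[ℂ] (IBondY (f j).toKIdx → 𝔸)))
  (𝔮s : ∀ j : J, CfgY 𝔸 (f j).toKIdx → ((IBondY (f j).toKIdx → 𝔸) →ₗ[ℂ] (FBondY (f j).toKIdx → 𝔸)))
  (par : ∀ j : J, SiteParY 𝔸 (f j).toKIdx) (parB : ∀ j : J, BondParY 𝔸 (f j).toKIdx)
  {ι : Type} [Fintype ι] [DecidableEq ι] (b : Module.Basis ι ℝ 𝔸) (ιB : ∀ j : J, BlkY (f j).toKIdx → IBondY (f j).toKIdx)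
  (C37 C38 : ∀ j : J, ℝ → CfgY 𝔸 (f j).toKIdx → AfldY 𝔸 (f j).toKIdx → Prop)


set_option maxHeartbeats 3200000 in
set_option maxRecDepth 2048 in
/-- ★★★ **THE DISPLAYED (3.77) FIELD OF THE G FRAME AT A GENERIC AVERAGING PAIR IS A THEOREM**: `Read377L2 (gFrame₅CodedOnSelQ …)` — S3's
`read377L2_gFrame₅CodedOnSel` assembly VERBATIM at `F := gFrame₅CodedOnSelQ …` (it reads the frame's SITE letters `Gop ∕ Qc ∕ Qcs ∕ Cop` and the `KSC` blocks only;
the averaging pair enters nowhere), `FL := l2Frame₂CodedOnSel …`.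
[cite: Balaban1985BackgroundPropagators, (3.77) p.406, Thm 3.4 p.400, Thm 3.2 (3.48) p.398, (3.42) p.397, (3.63)–(3.67) p.403, (3.35)–(3.37) p.396; Balaban1984PropagatorsII, Prop. 2.6 (2.140) p.247, Lemma 2.1 p.234] -/
theorem read377L2_gFrame₅CodedOnSelQ (hι : ∀ (j : J) (s : BlkY (f j).toKIdx), β (f j).toKIdx.hN (f j).toKIdx.D (f j).toKIdx.hk (ιB j s) = s)
    (hG1 : ∀ u : 𝔸ˣ, u ∈ G → ‖(u : 𝔸)‖ ≤ 1)
    (M₂ : ℝ) (hM₂ : 0 ≤ M₂) (hrepr : ∀ (v : 𝔸) (j : ι), |b.repr v j| ≤ M₂ * ‖v‖) (hcR : 0 < M₂ * ∑ j, ‖b j‖)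
    (Cq : ℝ) (hCq : 0 ≤ Cq) (hC37 : ∀ j β' U a, C37 j β' U a → GVal G (f j).toKIdx U ∧ CplxLettersY G (f j) (par j) (ιB j) Cq β' U a)
    (MInv aInv aW : ℝ) (hMInv : 0 < MInv) (haInv : 0 < aInv) (haW : 0 < aW)
    (hparG : ∀ j (α₀ : ℝ) (U : CfgY 𝔸 (f j).toKIdx), MInv ≤ (geo9Y (f j)).M → 0 < α₀ → (geo9Y (f j)).M * α₀ ≤ aInv →
      (bg9YC 𝔸 G P (f j)).Reg335 c35 α₀ U → ∀ z w, par j U z w ∈ G)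
    (hparC : ∀ j β' U a, C37 j β' U a → ∀ z w, par j U z w ∈ G)
    (hunitG : ∀ j (α₀ : ℝ) (U : CfgY 𝔸 (f j).toKIdx), MInv ≤ (geo9Y (f j)).M → 0 < α₀ → (geo9Y (f j)).M * α₀ ≤ aInv →
      (bg9YC 𝔸 G P (f j)).Reg335 c35 α₀ U → IsUnit (deltaPrimeAY (f j).toKIdx (par j) U))
    (hunitXG : ∀ j (α₀ : ℝ) (U : CfgY 𝔸 (f j).toKIdx), MInv ≤ (geo9Y (f j)).M → 0 < α₀ → (geo9Y (f j)).M * α₀ ≤ aInv →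
      (bg9YC 𝔸 G P (f j)).Reg335 c35 α₀ U → IsUnit (XY (f j).toKIdx (par j) (GpY (f j).toKIdx (par j)) U))
    (hsym : ∀ j (U : CfgY 𝔸 (f j).toKIdx) (z w : SiteY (f j).toKIdx), par j U z w = (par j U w z)⁻¹)
    (hunitA : ∀ j (α₀ : ℝ) (U : CfgY 𝔸 (f j).toKIdx), MInv ≤ (geo9Y (f j)).M → 0 < α₀ → (geo9Y (f j)).M * α₀ ≤ aInv →
      (bg9YC 𝔸 G P (f j)).Reg335 c35 α₀ U → IsUnit (deltaAQY (f j).toKIdx (𝔮 j) (𝔮s j) (par j) (GpY (f j).toKIdx (par j)) U))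
    (hb₁ : 0 ≤ b₁)
    (C₀ : ℝ) (hC₀ : 0 ≤ C₀)
    (hreg335P : ∀ j (α₀ : ℝ) (U : CfgY 𝔸 (f j).toKIdx), MInv ≤ (geo9Y (f j)).M → 0 < α₀ → (geo9Y (f j)).M * α₀ ≤ aInv →
      (bg9YC 𝔸 G P (f j)).Reg335 c35 α₀ U → Reg335PlaqY G (f j) (ιB j) C₀ U)
    (hC37G : ∀ j β' U a, C37 j β' U a → CplxLettersGY G (f j) (ιB j) β' U a)
    -- [K2-G] the DISPLAYED LAWS of the averaging pair `(𝔮, 𝔮s)`, GUARDED like `hparG ∕ hunitA`: (3.15) block majorants of `𝔮 ∕ 𝔮s` at (3.35)-regular bases above the thresholds, (3.80) variations at (3.37) pairs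
    (κQ : ℝ) (hκQ : 0 ≤ κQ)
    (hQ15 : ∀ j (α₀ : ℝ) (U : CfgY 𝔸 (f j).toKIdx) (δ : ℝ), MInv ≤ (geo9Y (f j)).M → 0 < α₀ → (geo9Y (f j)).M * α₀ ≤ aInv →
      (bg9YC 𝔸 G P (f j)).Reg335 c35 α₀ U → 0 < δ → δ ≤ 1 →
      HasMajorant (g := toB6 (geo9Y (f j)) 0 True) (fun q : (Fin (d + 1) × SiteY (f j).toKIdx) × ι => blkC (f j).toKIdx (ιB j) q.1.2)
          (QbQC (f j).toKIdx (𝔮 j) b (.base U)) (fun a a' => κQ * Real.exp (-(δ * (geo9Y (f j)).dist a a'))) ∧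
        HasMajorant (g := toB6 (geo9Y (f j)) 0 True) (fun q : (Fin (d + 1) × SiteY (f j).toKIdx) × ι => blkC (f j).toKIdx (ιB j) q.1.2)
          (QsbQC (f j).toKIdx (𝔮s j) b (.base U)) (fun a a' => κQ * Real.exp (-(δ * (geo9Y (f j)).dist a a'))))
    (cF : ℝ) (hcF : 0 ≤ cF)
    (hQ80 : ∀ j (β' : ℝ) (U : CfgY 𝔸 (f j).toKIdx) (a : AfldY 𝔸 (f j).toKIdx), 0 < β' → C37 j β' U a → ∀ δ : ℝ, 0 < δ → δ ≤ 1 →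
      HasMajorant (g := toB6 (geo9Y (f j)) 0 True) (fun q : (Fin (d + 1) × SiteY (f j).toKIdx) × ι => blkC (f j).toKIdx (ιB j) q.1.2)
          (F₂QC (f j).toKIdx (𝔮 j) b (.base U) (.mult a)) (fun a₁ a₂ => cF * β' * Real.exp (-(δ * (geo9Y (f j)).dist a₁ a₂))) ∧
        HasMajorant (g := toB6 (geo9Y (f j)) 0 True) (fun q : (Fin (d + 1) × SiteY (f j).toKIdx) × ι => blkC (f j).toKIdx (ιB j) q.1.2)
          (F₂sQC (f j).toKIdx (𝔮s j) b (.base U) (.mult a)) (fun a₁ a₂ => cF * β' * Real.exp (-(δ * (geo9Y (f j)).dist a₁ a₂))))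
    (hMd : 2 * ((d : ℝ) + 1) < MInv) (mN : ℕ) (hnbr : ∀ (j : J) (y' : IBondY (f j).toKIdx), (nbr (geo9Y (f j)) (2 * ((d : ℝ) + 1)) y').card ≤ mN) :
    Read377L2 (gFrame₅CodedOnSelQ P f c35 G 𝔮 𝔮s par parB b ιB C37 C38 hι hG1 M₂ hM₂ hrepr hcR Cq hCq hC37 MInv aInv aW hMInv haInv haW hparG hparC hunitG hunitXG hsym hunitA
        hb₁ C₀ hC₀ hreg335P hC37G κQ hκQ hQ15 cF hcF hQ80 hMd mN hnbr) := by
  set F := gFrame₅CodedOnSelQ P f c35 G 𝔮 𝔮s par parB b ιB C37 C38 hι hG1 M₂ hM₂ hrepr hcR Cq hCq hC37 MInv aInv aW hMInv haInv haW hparG hparC hunitG hunitXG hsym hunitA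
        hb₁ C₀ hC₀ hreg335P hC37G κQ hκQ hQ15 cF hcF hQ80 hMd mN hnbr with hFdef
  intro B₀ δ₀ B₁ δ₁ hB₀ hδ₀ hB₁ hδ₁
  classical
  -- the lineage's constants
  have hSb : 0 ≤ ∑ j, ‖b j‖ := Finset.sum_nonneg fun j _ => norm_nonneg _
  have hSb2 : 0 ≤ Real.sqrt (∑ j, ‖b j‖ ^ 2) := Real.sqrt_nonneg _
  have hne : Nonempty ι := by
    by_contra h
    rw [not_nonempty_iff] at h
    simp at hcR
  have hsq : 0 < Real.sqrt (Fintype.card ι : ℝ) := Real.sqrt_pos.2 (by exact_mod_cast Fintype.card_pos)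
  have hcL : 0 < Real.sqrt (Fintype.card ι) * M₂ * ∑ j, ‖b j‖ := by rw [mul_assoc]; exact mul_pos hsq hcR
  set cLY : ℝ := Real.sqrt (Fintype.card ι) * M₂ * ∑ j, ‖b j‖ with hcLY
  -- gen 9's `L²` frame at the augmented readings `KSC₃` (same root data as `F`)
  set FL := l2Frame₂CodedOnSel P f c35 G b C37 C38 par ιB hι hG1 (d + 1) M₂ hM₂ hrepr hcR hcL Cq hCq hC37 MInv aInv aW hMInv haInv haW hparG hparC
    hunitG with hFLdef
  -- the G′-side input conversion: rate `δh = δ₀/2`, the `KSC₃` block constant `BL3` (before the member)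
  set δh : ℝ := δ₀ / 2 with hδh
  have hδh0 : 0 < δh := by positivity
  have hδhδ₀ : δh ≤ δ₀ := by rw [hδh]; linarith only [hδ₀]
  set Λ4 : ℝ := ((ℓ : ℝ) + 1) ^ 4 with hΛ4
  have hΛ41 : (1 : ℝ) ≤ Λ4 := one_le_pow₀ (by have : (0 : ℝ) ≤ ℓ := Nat.cast_nonneg ℓ; linarith)
  set dL0 : ℕ := d261Y (d := d) (ℓ := ℓ) (hd := hd) (hL := hL) (b₀ := b₀) (b₁ := b₁) (Mstar := Mstar) δ₀ with hdL0
  set BL3 : ℝ := cLY * max (crossConstL2 M₂ (∑ j, ‖b j‖) (Real.sqrt (Fintype.card ι)) d dL0 δ₀ Λ4 B₀)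
      (cross2ConstL2 (2 * C₀) M₂ (∑ j, ‖b j‖) (Real.sqrt (Fintype.card ι)) d dL0 δ₀ Λ4 B₀) with hBL3
  have hBL30 : 0 ≤ BL3 :=
    mul_nonneg hcL.le (le_max_of_le_left (crossConstL2_nonneg hM₂ hSb hsq.le d dL0 δ₀ Λ4 hB₀.le))
  set B₀' : ℝ := max B₀ BL3 with hB₀'
  have hB₀'0 : 0 < B₀' := lt_max_of_lt_left hB₀
  -- the block-ℓ² entries of G′(U′U) (left: members 0, 1; right: member 2) from the `L²` frame at `KSC₃`, constants BEFORE the member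
  obtain ⟨a₃, ha₃, B₃, hB₃, H3⟩ := l2entries_ext_of_l2Frame₂ FL hB₀'0 hδh0
  obtain ⟨a₄, ha₄, B₄, hB₄, H4⟩ := l2rightEntries_ext_of_l2Frame₂ FL (fun j α₀ c B δ hM'' hα₀'' hMa'' hreg hB _ hL2 k => by
      obtain ⟨U, rfl, hU⟩ := (codingYx P G (f j) (C37 j) (C38 j)).exists_of_bg_Reg335 hreg
      have hR : InRegY G (f j).toKIdx (par j) U := ⟨hU.1.1, hparG j α₀ U hM'' hα₀'' hMa'' hU⟩
      rw [hFLdef]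
      dsimp only [l2Frame₂CodedOnSel, gpFrame₂CodedOnSel]
      erw [parSelC_base_of_inRegY G (f j).toKIdx (par j) hR]
      exact readL2_two_KSC₃ P G (f j) (par j) (C37 j) (C38 j) b (ιB j) (hι j) hM₂ hrepr hU.1.1 hB.le hL2 k) hB₀'0 hδh0
  -- the call rate δ′ (≤ δh, δ₁, δcap and ≤ both output rates of the G′(U′U) entries) and the assembly rate δF = 9δ′/25
  set δ' : ℝ := min (F.rate (min δh δ₁)) (rateR (FL.rate δh)) with hδ'
  have hrate0 : 0 < FL.rate δh := FL.rate_pos hδh0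
  have hδ'0 : 0 < δ' := lt_min (F.rate_pos (lt_min hδh0 hδ₁)) (rateR_pos hrate0)
  have hδ'c : δ' ≤ F.δcap := le_trans (min_le_left _ _) (F.rate_le_cap _)
  have hδ'δh : δ' ≤ δh := le_trans (min_le_left _ _) (le_trans (F.rate_le _) (min_le_left _ _))
  have hδ'δ₀ : δ' ≤ δ₀ := hδ'δh.trans hδhδ₀
  have hδ'δ₁ : δ' ≤ δ₁ := le_trans (min_le_left _ _) (le_trans (F.rate_le _) (min_le_right _ _))
  have hδ'R : δ' ≤ rateR (FL.rate δh) := min_le_right _ _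
  have hδ'L : δ' ≤ (1 - 1 / 100) * (49 / 50 * FL.rate δh) := by
    refine hδ'R.trans ?_; unfold rateR; nlinarith only [hrate0]
  set δF : ℝ := 9 / 25 * δ' with hδF
  have hδF0 : 0 < δF := by positivity
  have hδFc : δF ≤ F.δcap := by rw [hδF]; nlinarith only [hδ'c, hδ'0]
  have hδFδ' : δF ≤ δ' := by rw [hδF]; nlinarith only [hδ'0]
  -- r06's uniform clauses (R1) at the call rate: G′ (for the inverse identities) and C⁻¹ OVER THE BLOCK CARRIER
  have hBG : 0 < F.cR * B₀ := mul_pos F.cR_pos hB₀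
  obtain ⟨a₁, ha₁, B', -, H⟩ := thm34_Gp_uniform b (Fin (d + 1)) (F.d261 δ') δ' (F.cR * B₀) F.Cq F.a₀ F.d₀ F.M₂ (F.Λf δ')
    hBG F.Cq_nonneg F.a₀_nonneg F.M₂_nonneg hδ'0 (fun α hα => F.Λf_one_le _ α hδ'0 hα) F.hrepr
  obtain ⟨a₂, ha₂, H'⟩ := thm34_Cinv_uniform_blk b (Fin (d + 1)) (F.d261 δ') δ' F.κQ (F.cR * B₀) (F.cK * B₁) F.cF F.Cq F.a₀ F.d₀ F.M₂ (F.Λf δ')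
    F.κQ_pos hBG (mul_pos F.cK_pos hB₁) F.cF_pos F.Cq_nonneg F.a₀_nonneg F.M₂_nonneg hδ'0 (fun α hα => F.Λf_one_le _ α hδ'0 hα) F.hrepr
  -- frame-level constants of the assembly
  set BL : ℝ := cLY * BL3 with hBL
  have hBL0 : 0 ≤ BL := mul_nonneg hcL.le hBL30
  set BG : ℝ := BL + B₃ + B₄ with hBGdef
  have hBG0 : 0 ≤ BG := by positivity
  have hBLle : BL ≤ BG := by rw [hBGdef]; linarith only [hB₃, hB₄]
  have hB₃le : B₃ ≤ BG := by rw [hBGdef]; linarith only [hBL0, hB₄]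
  have hB₄le : B₄ ≤ BG := by rw [hBGdef]; linarith only [hBL0, hB₃]
  set ΘV : ℝ := 2 * BL * F.Λf δ' (1 / 100) * B6.c1 (F.d261 δ') δ' (1 / 100) *
    cVL2 (Fintype.card (Fin (d + 1))) (Fintype.card ι) 1 1 F.a₀ F.Cq F.M₂ (∑ j, ‖b j‖) (Real.sqrt (∑ j, ‖b j‖ ^ 2)) (Real.exp (δ' * F.d₀)) with hΘV
  set ΘW : ℝ := BL * F.Λf δ' (1 / 100) * B6.c1 (F.d261 δ') δ' (1 / 100) *
    (cVL2 (Fintype.card (Fin (d + 1))) (Fintype.card ι) 1 1 F.a₀ F.Cq F.M₂ (∑ j, ‖b j‖) (Real.sqrt (∑ j, ‖b j‖ ^ 2)) (Real.exp (δ' * F.d₀)) +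
      2 * Fintype.card (Fin (d + 1)) * (2 * (1 : ℝ) ^ 2 * F.M₂ * (∑ j, ‖b j‖) * Real.sqrt ((1 * Fintype.card ι : ℕ) : ℝ) * Real.exp (δ' * F.d₀))) with hΘW
  have hΛ'1 : 1 ≤ F.Λf δ' (1 / 100) := F.Λf_one_le δ' _ hδ'0 (by norm_num)
  have hΛ'0 : 0 ≤ F.Λf δ' (1 / 100) := zero_le_one.trans hΛ'1
  have hcV1 : 0 ≤ cVL2 (Fintype.card (Fin (d + 1))) (Fintype.card ι) 1 1 F.a₀ F.Cq F.M₂ (∑ j, ‖b j‖) (Real.sqrt (∑ j, ‖b j‖ ^ 2)) (Real.exp (δ' * F.d₀)) :=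
    cVL2_nonneg (d := Fintype.card (Fin (d + 1))) (nι := Fintype.card ι) (ρu := 1) zero_le_one F.a₀_nonneg F.Cq_nonneg F.M₂_nonneg hSb hSb2
      (Real.exp_nonneg (δ' * F.d₀))
  have hc1' : 0 ≤ B6.c1 (F.d261 δ') δ' (1 / 100) := B6RandomWalk.c1_nonneg (F.d261 δ') δ' (1 / 100)
  have hΘV0 : 0 ≤ ΘV := by rw [hΘV]; positivity
  have hΘW0 : 0 ≤ ΘW := by have := F.M₂_nonneg; rw [hΘW]; positivity
  set BC : ℝ := Real.sqrt (Fintype.card ι) * (F.cK * B₁) with hBC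
  have hBC0 : 0 ≤ BC := mul_nonneg hsq.le (mul_pos F.cK_pos hB₁).le
  set BC' : ℝ := Real.sqrt (Fintype.card ι) * (2 * (F.cK * B₁) * B6.c1 (F.d261 δ') (2 / 5 * δ') (1 / 10)) with hBC'
  have hBC'' : 0 ≤ 2 * (F.cK * B₁) * B6.c1 (F.d261 δ') (2 / 5 * δ') (1 / 10) := by
    have := B6RandomWalk.c1_nonneg (F.d261 δ') (2 / 5 * δ') (1 / 10); have := mul_pos F.cK_pos hB₁; positivity
  have hBC'0 : 0 ≤ BC' := mul_nonneg hsq.le hBC''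
  set ΛF : ℝ := F.Λf δF (1 / 100) with hΛF
  have hΛF1 : 1 ≤ ΛF := F.Λf_one_le δF _ hδF0 (by norm_num)
  set cFL : ℝ := B6.c1 (F.d261 δF) δF (1 / 100) with hcFL
  have hcFL0 : 0 ≤ cFL := B6RandomWalk.c1_nonneg _ _ _
  set ΛC0 : ℝ := ((ℓ : ℝ) + 1) ^ ((((d : ℝ)) + 1) / 2) with hΛC0
  have hΛC00 : 0 ≤ ΛC0 := Real.rpow_nonneg (by have : (0 : ℝ) ≤ ℓ := Nat.cast_nonneg ℓ; linarith) _
  -- the structured-reading constants of §1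
  set κc : ℝ := cLY * (1 + Cq) with hκc
  set θc : ℝ := cLY * Cq with hθc
  have hκc0 : 0 ≤ κc := by rw [hκc]; positivity
  have hθc0 : 0 ≤ θc := by rw [hθc]; positivity
  -- the (3.68) and (3.49) constants and the (3.77) constant at α₁ = 1
  set KPp : ℝ := (1 + Fintype.card (Fin (d + 1))) * kappa368F (F.Λf δF (1 / 100)) (B6.c1 (F.d261 δF) δF (1 / 100)) ΛC0 ΛC0 ΛC0 κc κc θc θc BG ΘV ΘW BC BC'
    with hKPp
  set KP : ℝ := (1 + Real.sqrt (Fintype.card (Fin (d + 1)))) * kappa349 1 BG (κc * κc * BC * ΛC0) ΛF cFL with hKP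
  have hKP0 : 0 ≤ KP := by rw [hKP]; unfold kappa349; positivity
  have hKPp0 : 0 ≤ KPp := by
    rw [hKPp]
    have hcard : (0 : ℝ) ≤ Fintype.card (Fin (d + 1)) := Nat.cast_nonneg _
    have : 0 ≤ kappa368F (F.Λf δF (1 / 100)) (B6.c1 (F.d261 δF) δF (1 / 100)) ΛC0 ΛC0 ΛC0 κc κc θc θc BG ΘV ΘW BC BC' := by
      have := zero_le_one.trans hΛF1
      unfold kappa368F B9Ineq368L2F.thetaM B9Ineq368L2F.thetaI B9Ineq368L2F.thetaC; positivity
    positivity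
  set cE : ℝ := Real.sqrt (((Fintype.card (Fin (d + 1)) + 1) * Fintype.card ι : ℕ) : ℝ) * (4 * (1 + Fintype.card (Fin (d + 1))) * (F.M₂ * ∑ j, ‖b j‖) *
    Real.exp (21 / 25 * δF * F.d₀)) with hcE
  have hcE0 : 0 ≤ cE := by rw [hcE]; have := F.M₂_nonneg; positivity
  set κ₇ : ℝ := kappa377 cE KP KPp ΛF cFL 1 with hκ₇
  have hκ₇0 : 0 ≤ κ₇ := kappa377_nonneg hcE0 hKP0 hKPp0 (zero_le_one.trans hΛF1) hcFL0 zero_le_one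
  -- thresholds and the α₁-window
  set a : ℝ := min (min a₁ a₂) (min (min a₃ a₄) (1 / 4)) with ha_def
  have ha0 : 0 < a := lt_min (lt_min ha₁ ha₂) (lt_min (lt_min ha₃ ha₄) (by norm_num))
  set MC : ℝ := (((d : ℝ)) + 1) / 2 * Real.log ((ℓ : ℝ) + 1) / (9 / 5000 * δF) with hMC
  refine ⟨max (max (max (F.Mthr δ') (F.Mthr δF)) (FL.Mthr (FL.rate δh)))
      (max (max (M261Y (d := d) (ℓ := ℓ) (hd := hd) (hL := hL) (b₀ := b₀) (b₁ := b₁) (Mstar := Mstar) δ₀) (4 * Real.log ((ℓ : ℝ) + 1) / (δ₀ / 12))) MC),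
    a, κ₇, 4 / 5 * δF, lt_max_of_lt_left (lt_max_of_lt_left (lt_max_of_lt_left (F.Mthr_pos _))), ha0, hκ₇0, by positivity, ?_⟩
  intro i α₀ U hM0 hα₀ hMa hU hE hL2 hKer α₁ U' hα₁ ha hU'
  have hM' : F.Mthr δ' ≤ (geo9Y (f i)).M := le_trans (le_trans (le_trans (le_max_left _ _) (le_max_left _ _)) (le_max_left _ _)) hM0
  have hMF : F.Mthr δF ≤ (geo9Y (f i)).M := le_trans (le_trans (le_trans (le_max_right _ _) (le_max_left _ _)) (le_max_left _ _)) hM0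
  have hM3 : FL.Mthr (FL.rate δh) ≤ (geo9Y (f i)).M := le_trans (le_trans (le_max_right _ _) (le_max_left _ _)) hM0
  have hM261 : M261Y (d := d) (ℓ := ℓ) (hd := hd) (hL := hL) (b₀ := b₀) (b₁ := b₁) (Mstar := Mstar) δ₀ ≤ (geo9Y (f i)).M :=
    le_trans (le_trans (le_trans (le_max_left _ _) (le_max_left _ _)) (le_max_right _ _)) hM0
  have hMST : 4 * Real.log ((ℓ : ℝ) + 1) / (δ₀ / 12) ≤ (geo9Y (f i)).M :=
    le_trans (le_trans (le_trans (le_max_right _ _) (le_max_left _ _)) (le_max_right _ _)) hM0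
  have hMCle : MC ≤ (geo9Y (f i)).M := le_trans (le_trans (le_max_right _ _) (le_max_right _ _)) hM0
  have hM : F.MInv ≤ (geo9Y (f i)).M := F.MInv_le_of_Mthr_le hM'
  have ha1 : α₁ ≤ a₁ := ha.trans ((min_le_left _ _).trans (min_le_left _ _))
  have ha2 : α₁ ≤ a₂ := ha.trans ((min_le_left _ _).trans (min_le_right _ _))
  have ha3 : α₁ ≤ a₃ := ha.trans ((min_le_right _ _).trans ((min_le_left _ _).trans (min_le_left _ _)))
  have ha4 : α₁ ≤ a₄ := ha.trans ((min_le_right _ _).trans ((min_le_left _ _).trans (min_le_right _ _)))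
  have haq : α₁ ≤ 1 / 4 := ha.trans ((min_le_right _ _).trans (min_le_right _ _))
  have hα1 : α₁ ≤ 1 := haq.trans (by norm_num)
  have hw2 : ∀ a : (geo9Y (f i)).Site, 0 ≤ (geo9Y (f i)).len a ^ 2 := fun a => sq_nonneg _
  have hw1 : ∀ a : (geo9Y (f i)).Site, 0 ≤ (geo9Y (f i)).len a := fun a => (F.len_pos i a).le
  -- decoding the configurations: `U = base V`, `U′ = mult aa` (the coded classes live at such pairs only)
  obtain ⟨V, rfl, hV335⟩ := (codingYx P G (f i) (C37 i) (C38 i)).exists_of_bg_Reg335 hU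
  obtain ⟨V₁, aa, hVV, rfl, hC1⟩ := (codingYx P G (f i) (C37 i) (C38 i)).exists_of_bg_Cplx337 hU'
  have hVV' : V = V₁ := by injection hVV
  subst hVV'
  set U : (codingYx P G (f i) (C37 i) (C38 i)).bg.Cfg := CCfg.base V with hUdef
  set U' : (codingYx P G (f i) (C37 i) (C38 i)).bg.Cfg := CCfg.mult aa with hU'def
  have hVval : GVal G (f i).toKIdx V := hV335.1.1
  -- the regime of the selected transporter at the regular base `V`: the frame's letters ARE the letters at `par i`
  have hR : InRegY G (f i).toKIdx (par i) V := ⟨hVval, hparG i α₀ V hM hα₀ hMa hV335⟩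
  have hsel : parSelC G (f i).toKIdx (par i) (.base V) = par i := parSelC_base_of_inRegY G (f i).toKIdx (par i) hR
  have hselp : parSelC G (f i).toKIdx (par i) (.prod V aa) = par i := parSelC_prod_of_inRegY G (f i).toKIdx (par i) hR aa
  -- ★ the G′-side input at U converted to the augmented readings `KSC₃` (Lemma 2.1, p. 398 transfers, the plaquette law)
  have hL2rec := l2Block_record_of_KSC_base P (f i) G (par i) (C37 i) (C38 i) hL2
  have h261₀ := d261Y_spec (f i) hδ₀ (by norm_num : (9 : ℝ) / 5000 ≤ 1 / 12) (by norm_num) hM261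
  have hκlo₀ : 0 < δ₀ / 12 := by positivity
  obtain ⟨hT1₀, -, -, hT2i₀, -, -⟩ := scaleTransfer6_window_geo9Y hκlo₀ (f i) (δ := δ₀) (α := 1 / 12) (by linarith only [hδ₀]) hMST
  have hTi2₀ : ScaleTransfer (geo9Y (f i)) δ₀ (1 / 12) Λ4 (fun a => ((geo9Y (f i)).len a)⁻¹ ^ 2) := by
    have e : (fun a => ((geo9Y (f i)).len a)⁻¹ ^ 2) = (fun a => ((geo9Y (f i)).len a ^ 2)⁻¹) := funext fun a => by rw [inv_pow]
    rw [e]; exact hT2i₀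
  have hplaq := plaqLawY_of_reg335PlaqY G (f i) (ιB i) hG1 hVval hC₀ (hreg335P i α₀ V hM hα₀ hMa hV335)
  have hC₀2 : 0 ≤ 2 * C₀ := by positivity
  have hK3 : L2Block (KSC₃ P G (f i) (par i) (C37 i) (C38 i)) BL3 δh U :=
    l2Block_KSC₃_base_of_record P G (f i) (par i) b (ιB i) (C37 i) (C38 i) (hι i) hG1 hM₂ hrepr hδ₀ h261₀ hΛ41 hT1₀ hTi2₀ hC₀2 hB₀.le hVval
      hplaq hL2rec
  have hE3 : EBlock (KSC₃ P G (f i) (par i) (C37 i) (C38 i)) B₀' δh U :=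
    (eBlock_KSC₃_iff P G (f i) (par i) (C37 i) (C38 i) B₀' δh U).2 (eBlock_weaken (f i) _ hB₀.le (le_max_left _ _) hδhδ₀ hE)
  have hK3' : L2Block (KSC₃ P G (f i) (par i) (C37 i) (C38 i)) B₀' δh U := l2Block_weaken (f i) _ hBL30 (le_max_right _ _) le_rfl hK3
  -- Theorem 3.1's `L²` members of G′ at U in the frame shapes (constant `BL`, rate `δh`) and the entries of G′(U′U)
  obtain ⟨l0, l1⟩ := readL2_KSC₃ P G (f i) (par i) (C37 i) (C38 i) b (ιB i) (hι i) hM₂ hrepr hVval hBL30 hK3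
  have r2 := readL2_two_KSC₃ P G (f i) (par i) (C37 i) (C38 i) b (ιB i) (hι i) hM₂ hrepr hVval hBL30 hK3
  -- the letters of the member ARE the frame's (by `rfl`); restate the readings in the frame's terms
  have eG : GopC (f i).toKIdx (par i) b (.base V) = F.Gop i U := by
    show _ = GopC (f i).toKIdx (parSelC G (f i).toKIdx (par i) (.base V)) b (.base V); rw [hsel]
  have eco : coordC G (f i).toKIdx (.base V) = F.coord i U := rfl
  have eT : Node00.shiftY (f i).toKIdx = F.T i := rfl
  rw [eG] at l0
  rw [eG, eco, eT] at l1 r2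
  obtain ⟨e0, e1⟩ := H3 i α₀ U hM3 hα₀ hMa hU hE3 hK3' α₁ U' hα₁ ha3 hU'
  have e2 := H4 i α₀ U hM3 hα₀ hMa hU hE3 hK3' α₁ U' hα₁ ha4 hU'
  have hδFδh : δF ≤ δh := hδFδ'.trans hδ'δh
  have hδFL : δF ≤ (1 - 1 / 100) * (49 / 50 * FL.rate δh) := hδFδ'.trans hδ'L
  have hδFR : δF ≤ rateR (FL.rate δh) := hδFδ'.trans hδ'R
  -- the letters at U: inverse identities, sup readings for r06, the class (3.37), (3.57)
  obtain ⟨hΔG, hGΔ⟩ := F.reg_inv i α₀ U hM hα₀ hMa hU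
  obtain ⟨h1, h2, h3, -⟩ := F.read342_le i α₀ U hM hα₀ hMa hU hB₀ hδ₀ hδ'δ₀ hE
  obtain ⟨hkF, hsF, h337s, h337F, h337B, hA, hAτ⟩ := F.cplx i α₁ U U' hα₁ hU'
  obtain ⟨hQm, hQsm⟩ := F.q_mul i α₁ U U' hα₁ hU'
  obtain ⟨hFc, hFcs⟩ := F.hF i α₁ U U' hα₁ hU'
  -- the G′ clause: the family's G′(U′U) is r06's extension
  obtain ⟨hinv1, hinv2, -, -⟩ := H (F.T i) (F.coord i U) (F.blk i) (F.kQ i U) (F.sQ i U) (F.cfun i) (F.w i U)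
    (F.dist_nonneg i) (F.triangle i) (F.dist_self i) (F.dist_comm i) (F.len_pos i) (F.eta_le_len i) (F.eta_pos i)
    (F.h261_of i hδ'0 hδ'c hM') (F.hST_of i hδ'0 hδ'c hM') (F.unitary i U)
    (F.stencilB i) (F.stencilF i) (F.stencil0 i) (F.w_nonneg i U) (F.card_w i U) (F.hkQ i U) (F.hsQ i U) (F.hcfun i)
    hΔG hGΔ h1 h2 h3 α₁ hα₁.le ha1 (F.expA i U U') (F.kF i U U') (F.sF i U U')
    hkF hsF h337s h337F h337B hA hAτ
  have hG := F.gop_eq i ((codingYx P G (f i) (C37 i) (C38 i)).bg.mul U' U) _ _ (F.mul_law i α₁ U U' hα₁ hU') hinv1 hinv2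
  -- the C⁻¹ clause OVER THE BLOCK CARRIER: the (3.48) kernel at U read as a block majorant (lowered to δ′), r06's inverse at U′U with its block majorant
  have hK := F.readKer i α₀ U B₁ δ₁ hM hα₀ hMa hU hB₁ hδ₁ hKer
  have hK' : HasMajorant (g := toB6 (geo9Y (f i)) (F.Rr i) (F.Hp i)) (F.blkP i) (F.Cop i U)
      (fun a a' => F.cK * B₁ * (geo9Y (f i)).len a ^ (-(4 : ℝ)) * Real.exp (-(δ' * (geo9Y (f i)).dist a a'))) := by
    refine hasMajorant_mono (g := toB6 (geo9Y (f i)) (F.Rr i) (F.Hp i)) (F.blkP i) hK fun a a' => ?_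
    refine mul_le_mul_of_nonneg_left (Real.exp_le_exp.2 ?_) ?_
    · nlinarith only [F.dist_nonneg i a a', hδ'δ₁]
    · exact mul_nonneg (mul_pos F.cK_pos hB₁).le (Real.rpow_nonneg (F.len_pos i a).le _)
  obtain ⟨Tinv, hT1, hT2, hker⟩ := H' (F.T i) (F.coord i U) (F.blk i) (F.blkP i) (F.kQ i U) (F.sQ i U) (F.cfun i) (F.w i U)
    (F.dist_nonneg i) (F.triangle i) (F.dist_self i) (F.dist_comm i) (F.len_pos i) (F.eta_le_len i) (F.eta_pos i)
    (F.h261_of i hδ'0 hδ'c hM') (F.hST_of i hδ'0 hδ'c hM') (F.unitary i U)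
    (F.stencilB i) (F.stencilF i) (F.stencil0 i) (F.w_nonneg i U) (F.card_w i U) (F.hkQ i U) (F.hsQ i U) (F.hcfun i)
    h1 h2 (F.hQc i α₀ U hM hα₀ hMa hU) (F.hQcs i α₀ U hM hα₀ hMa hU) (F.reg_cinv i α₀ U hM hα₀ hMa hU) hK' α₁ hα₁.le ha2
    (F.expA i U U') (F.kF i U U') (F.sF i U U') hkF hsF h337s hA hAτ hQm hQsm hFc hFcs
  rw [← hG] at hT1 hT2
  have hC := F.cop_eq i ((codingYx P G (f i) (C37 i) (C38 i)).bg.mul U' U) _ Tinv rfl hT1 hT2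
  rw [← hC] at hker hT1
  -- block-ℓ² majorants of C⁻¹(U), C⁻¹(U′U) on `P` at the assembly rate (sup ⟹ ℓ² with `√|ι|`)
  have hw4i : ∀ a : (geo9Y (f i)).Site, 0 ≤ ((geo9Y (f i)).len a ^ 4)⁻¹ := fun a => inv_nonneg.mpr (by positivity)
  have h348F : HasL2Majorant (g := toB6 (geo9Y (f i)) (F.Rr i) (F.Hp i)) (F.blkP i) (F.Cop i U)
      (fun a a' => BC * ((geo9Y (f i)).len a ^ 4)⁻¹ * Real.exp (-(δF * (geo9Y (f i)).dist a a'))) := by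
    have h := hasL2Majorant_blkP_of_hasMajorant (f i) (ιB i) (Rr := F.Rr i) (Hp := F.Hp i) (hι i) (mul_pos F.cK_pos hB₁).le hK'
    refine hasL2Majorant_mono (g := toB6 (geo9Y (f i)) (F.Rr i) (F.Hp i)) _ h fun a a' => ?_
    have hE' : Real.exp (-(δ' * (geo9Y (f i)).dist a a')) ≤ Real.exp (-(δF * (geo9Y (f i)).dist a a')) :=
      Real.exp_le_exp.2 (neg_le_neg (mul_le_mul_of_nonneg_right hδFδ' (F.dist_nonneg i a a')))
    calc Real.sqrt (Fintype.card ι) * (F.cK * B₁) * ((geo9Y (f i)).len a ^ 4)⁻¹ * Real.exp (-(δ' * (geo9Y (f i)).dist a a'))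
        ≤ Real.sqrt (Fintype.card ι) * (F.cK * B₁) * ((geo9Y (f i)).len a ^ 4)⁻¹ * Real.exp (-(δF * (geo9Y (f i)).dist a a')) :=
          mul_le_mul_of_nonneg_left hE' (mul_nonneg hBC0 (hw4i a))
      _ = _ := by rw [hBC]
  have h348F' : HasL2Majorant (g := toB6 (geo9Y (f i)) (F.Rr i) (F.Hp i)) (F.blkP i) (F.Cop i ((codingYx P G (f i) (C37 i) (C38 i)).bg.mul U' U))
      (fun a a' => BC' * ((geo9Y (f i)).len a ^ 4)⁻¹ * Real.exp (-(δF * (geo9Y (f i)).dist a a'))) := by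
    have h := hasL2Majorant_blkP_of_hasMajorant (f i) (ιB i) (Rr := F.Rr i) (Hp := F.Hp i) (hι i) hBC'' hker
    refine hasL2Majorant_mono (g := toB6 (geo9Y (f i)) (F.Rr i) (F.Hp i)) _ h fun a a' => le_of_eq ?_
    rw [hBC', hδF]
  -- the G′ entries lowered to the assembly rate and raised to the common constant `BG`
  have low := fun (A : ℝ) (w : (geo9Y (f i)).Site → ℝ) (hA : 0 ≤ A) (hw : ∀ a, 0 ≤ w a) {ρ r : ℝ} (h : ρ ≤ r)
      {T₀ : Module.End ℝ (SiteY (f i).toKIdx × ι → ℝ)}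
      (hT : HasL2Majorant (g := toB6 (geo9Y (f i)) (F.Rr i) (F.Hp i)) (fun p : SiteY (f i).toKIdx × ι => F.blk i p.1) T₀
        (fun a a' => A * w a * Real.exp (-(r * (geo9Y (f i)).dist a a')))) =>
    hasL2Majorant_rate_mono (R := F.Rr i) (H := F.Hp i) (fun p : SiteY (f i).toKIdx × ι => F.blk i p.1) A w hA hw h (F.dist_nonneg i) hT
  have up := fun {A : ℝ} (w : (geo9Y (f i)).Site → ℝ) (hw : ∀ a, 0 ≤ w a) (hA : A ≤ BG) {r : ℝ} {T₀ : Module.End ℝ (SiteY (f i).toKIdx × ι → ℝ)}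
      (hT : HasL2Majorant (g := toB6 (geo9Y (f i)) (F.Rr i) (F.Hp i)) (fun p : SiteY (f i).toKIdx × ι => F.blk i p.1) T₀
        (fun a a' => A * w a * Real.exp (-(r * (geo9Y (f i)).dist a a')))) =>
    hasL2Majorant_mono (g := toB6 (geo9Y (f i)) (F.Rr i) (F.Hp i)) _ hT fun a a' =>
      mul_le_mul_of_nonneg_right (mul_le_mul_of_nonneg_right hA (hw a)) (Real.exp_nonneg _)
  have g0m := up (fun a => (geo9Y (f i)).len a ^ 2) hw2 hBLle (low BL (fun a => (geo9Y (f i)).len a ^ 2) hBL0 hw2 hδFδh l0)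
  have g1m := fun μ : Fin (d + 1) => up (fun a => (geo9Y (f i)).len a) hw1 hBLle (low BL (fun a => (geo9Y (f i)).len a) hBL0 hw1 hδFδh (l1 (Sum.inl μ)))
  have g2m := fun ν : Fin (d + 1) => up (fun a => (geo9Y (f i)).len a) hw1 hBLle (low BL (fun a => (geo9Y (f i)).len a) hBL0 hw1 hδFδh (r2 (Sum.inr ν)))
  have hGt0 := up (fun a => (geo9Y (f i)).len a ^ 2) hw2 hB₃le (low B₃ (fun a => (geo9Y (f i)).len a ^ 2) hB₃ hw2 hδFL e0)
  have hGt1 := fun μ : Fin (d + 1) => up (fun a => (geo9Y (f i)).len a) hw1 hB₃le (low B₃ (fun a => (geo9Y (f i)).len a) hB₃ hw1 hδFL (e1 (Sum.inl μ)))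
  have hGt2 := fun ν : Fin (d + 1) => up (fun a => (geo9Y (f i)).len a) hw1 hB₄le (low B₄ (fun a => (geo9Y (f i)).len a) hB₄ hw1 hδFR (e2 (Sum.inr ν)))
  -- the block-ℓ² (3.63) both sides at the call rate δ′ (inputs lowered to δ′, output 49δ′/50 ≥ δF)
  have l0' := low BL (fun a => (geo9Y (f i)).len a ^ 2) hBL0 hw2 hδ'δh l0
  have l1' := fun k => low BL (fun a => (geo9Y (f i)).len a) hBL0 hw1 hδ'δh (l1 k)
  have r2' := fun k => low BL (fun a => (geo9Y (f i)).len a) hBL0 hw1 hδ'δh (r2 k)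
  have h261β : Ineq261 (F.d261 δ') (toB6 (geo9Y (f i)) (F.Rr i) (F.Hp i)) δ' (1 / 100) :=
    F.h261_of i hδ'0 hδ'c hM' (1 / 100) (by norm_num) (by norm_num)
  obtain ⟨sT1, sT2, sT1i, sT2i, -, -⟩ := F.hST_of i hδ'0 hδ'c hM' (1 / 100) (by norm_num)
  have hsmall4 : ∀ y : (geo9Y (f i)).Site, (geo9Y (f i)).eta * (α₁ * ((geo9Y (f i)).len y)⁻¹) ≤ 1 / 4 := by
    intro y
    have hl := F.len_pos i y
    have h1 : (geo9Y (f i)).eta * ((geo9Y (f i)).len y)⁻¹ ≤ 1 := by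
      rw [← div_eq_mul_inv]; exact (div_le_one hl).mpr (F.eta_le_len i y)
    calc (geo9Y (f i)).eta * (α₁ * ((geo9Y (f i)).len y)⁻¹) = α₁ * ((geo9Y (f i)).eta * ((geo9Y (f i)).len y)⁻¹) := by ring
      _ ≤ α₁ * 1 := mul_le_mul_of_nonneg_left h1 hα₁.le
      _ ≤ 1 / 4 := by rw [mul_one]; exact haq
  have hr : 49 / 50 * δ' + (1 / 100 + 1 / 100) * δ' ≤ δ' := by nlinarith only [hδ'0]
  have hW := ineq363_l2_vPrime (Rr := F.Rr i) (H := F.Hp i) b (F.T i) (F.coord i U) (F.blk i) (F.d261 δ') (F.eta_pos i)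
    (F.expA i U U') (F.kQ i U) (F.kF i U U') (F.sQ i U) (F.sF i U U') (F.cfun i) (F.w i U) 1 F.d₀ F.M₂ F.Cq F.a₀
    δ' δ' (1 / 100) (1 / 100) (49 / 50 * δ') (F.Λf δ' (1 / 100)) BL α₁
    hBL0 hα₁.le hΛ'0 (by positivity) (by norm_num) (by norm_num) hδ'0.le hδ'0.le hr
    (F.dist_nonneg i) (F.triangle i) (F.len_pos i) h261β sT1 sT2 F.M₂_nonneg F.hrepr hsmall4
    (fun μ x => ⟨hA μ x, hAτ μ μ x⟩) (fun μ x => h337s μ μ x) (fun μ x => F.unitary i U μ x)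
    (fun μ x => ⟨F.stencilF i μ x, F.stencilB i μ x⟩) (F.stencil0 i)
    (F.w_nonneg i U) (F.card_w i U) F.Cq_nonneg F.a₀_nonneg (F.hkQ i U) hkF (F.hsQ i U) hsF (F.hcfun i) l0' l1'
  have hMV := hasL2Majorant_gp_vPrime (Rr := F.Rr i) (H := F.Hp i) b (F.T i) (F.coord i U) (F.blk i) (F.d261 δ') (F.eta_pos i)
    (F.expA i U U') (F.kQ i U) (F.kF i U U') (F.sQ i U) (F.sF i U U') (F.cfun i) (F.w i U) 1 F.d₀ F.M₂ F.Cq F.a₀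
    δ' δ' (1 / 100) (1 / 100) (49 / 50 * δ') (F.Λf δ' (1 / 100)) BL α₁
    hBL0 hα₁.le hΛ'0 (by positivity) (by norm_num) (by norm_num) hδ'0.le hδ'0.le hr
    (F.dist_nonneg i) (F.triangle i) (F.len_pos i) h261β sT1i sT2i F.M₂_nonneg F.hrepr hsmall4
    (fun μ x => ⟨hA μ x, hAτ μ μ x⟩) (fun μ x => h337s μ μ x) (fun μ x => h337F μ μ x) h337B (fun μ x => F.unitary i U μ x)
    (fun μ x => ⟨F.stencilF i μ x, F.stencilB i μ x⟩) (F.stencil0 i)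
    (F.w_nonneg i U) (F.card_w i U) F.Cq_nonneg F.a₀_nonneg (F.hkQ i U) hkF (F.hsQ i U) hsF (F.hcfun i) l0' r2'
  -- θ ≤ Θ·α₁ on both sides (cVL2 monotone in α₁ ≤ 1), then lowered to δF
  have hcv := cVL2_le_one (dκ := Fintype.card (Fin (d + 1))) (nι := Fintype.card ι) (E₀ := Real.exp (δ' * F.d₀)) hα1 F.a₀_nonneg
    F.Cq_nonneg F.M₂_nonneg hSb hSb2 (Real.exp_nonneg _)
  have hρF : δF ≤ 49 / 50 * δ' := by rw [hδF]; nlinarith only [hδ'0]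
  have hVG : HasL2Majorant (g := toB6 (geo9Y (f i)) (F.Rr i) (F.Hp i)) (fun p : SiteY (f i).toKIdx × ι => F.blk i p.1)
      (conj b (vPrimeConc (F.T i) (F.coord i U) (geo9Y (f i)).eta (F.expA i U U') (F.blk i) (F.kQ i U) (F.kF i U U') (F.sQ i U)
        (F.sF i U U') (F.cfun i)) * F.Gop i U) (fun a a' => ΘV * α₁ * Real.exp (-(δF * (geo9Y (f i)).dist a a'))) := by
    refine hasL2Majorant_mono (g := toB6 (geo9Y (f i)) (F.Rr i) (F.Hp i)) _ hW fun a a' => ?_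
    have hpre : 0 ≤ 2 * BL * F.Λf δ' (1 / 100) * B6.c1 (F.d261 δ') δ' (1 / 100) := by positivity
    have hθ : 2 * BL * F.Λf δ' (1 / 100) * B6.c1 (F.d261 δ') δ' (1 / 100) *
        cVL2 (Fintype.card (Fin (d + 1))) (Fintype.card ι) 1 α₁ F.a₀ F.Cq F.M₂ (∑ j, ‖b j‖) (Real.sqrt (∑ j, ‖b j‖ ^ 2)) (Real.exp (δ' * F.d₀)) ≤ ΘV := by
      rw [hΘV]; exact mul_le_mul_of_nonneg_left hcv hpre
    have hE' : Real.exp (-(49 / 50 * δ' * (geo9Y (f i)).dist a a')) ≤ Real.exp (-(δF * (geo9Y (f i)).dist a a')) :=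
      Real.exp_le_exp.2 (neg_le_neg (mul_le_mul_of_nonneg_right hρF (F.dist_nonneg i a a')))
    calc _ ≤ ΘV * α₁ * Real.exp (-(49 / 50 * δ' * (geo9Y (f i)).dist a a')) :=
          mul_le_mul_of_nonneg_right (mul_le_mul_of_nonneg_right hθ hα₁.le) (Real.exp_nonneg _)
      _ ≤ _ := mul_le_mul_of_nonneg_left hE' (mul_nonneg hΘV0 hα₁.le)
  have hGV : HasL2Majorant (g := toB6 (geo9Y (f i)) (F.Rr i) (F.Hp i)) (fun p : SiteY (f i).toKIdx × ι => F.blk i p.1)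
      (F.Gop i U * conj b (vPrimeConc (F.T i) (F.coord i U) (geo9Y (f i)).eta (F.expA i U U') (F.blk i) (F.kQ i U) (F.kF i U U') (F.sQ i U)
        (F.sF i U U') (F.cfun i))) (fun a a' => ΘW * α₁ * Real.exp (-(δF * (geo9Y (f i)).dist a a'))) := by
    refine hasL2Majorant_mono (g := toB6 (geo9Y (f i)) (F.Rr i) (F.Hp i)) _ hMV fun a a' => ?_
    have hpre : 0 ≤ BL * F.Λf δ' (1 / 100) * B6.c1 (F.d261 δ') δ' (1 / 100) := by positivity
    have hθ : BL * F.Λf δ' (1 / 100) * B6.c1 (F.d261 δ') δ' (1 / 100) *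
        (cVL2 (Fintype.card (Fin (d + 1))) (Fintype.card ι) 1 α₁ F.a₀ F.Cq F.M₂ (∑ j, ‖b j‖) (Real.sqrt (∑ j, ‖b j‖ ^ 2)) (Real.exp (δ' * F.d₀)) +
          2 * Fintype.card (Fin (d + 1)) * (2 * (1 : ℝ) ^ 2 * F.M₂ * (∑ j, ‖b j‖) * Real.sqrt ((1 * Fintype.card ι : ℕ) : ℝ) * Real.exp (δ' * F.d₀))) ≤
        ΘW := by
      rw [hΘW]; exact mul_le_mul_of_nonneg_left (add_le_add hcv le_rfl) hpre
    have hE' : Real.exp (-(49 / 50 * δ' * (geo9Y (f i)).dist a a')) ≤ Real.exp (-(δF * (geo9Y (f i)).dist a a')) :=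
      Real.exp_le_exp.2 (neg_le_neg (mul_le_mul_of_nonneg_right hρF (F.dist_nonneg i a a')))
    calc _ ≤ ΘW * α₁ * Real.exp (-(49 / 50 * δ' * (geo9Y (f i)).dist a a')) :=
          mul_le_mul_of_nonneg_right (mul_le_mul_of_nonneg_right hθ hα₁.le) (Real.exp_nonneg _)
      _ ≤ _ := mul_le_mul_of_nonneg_left hE' (mul_nonneg hΘW0 hα₁.le)
  -- (3.65): the resolvent identities of the family's own G′(U′U)
  have h365 := eq365_of_inverse hΔG hinv2
  have h365' := eq365_first_of_inverse hGΔ hinv1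
  rw [← hG] at h365 h365'
  -- Lemma 2.1 and the transfers at the assembly rate; the volume transfer of `w_c`
  have h261F := F.h261_of i hδF0 hδFc hMF
  have hSTF : ∀ α : ℝ, 9 / 5000 ≤ α →
      ScaleTransfer (geo9Y (f i)) δF α (F.Λf δF α) (fun a => (geo9Y (f i)).len a) ∧
        ScaleTransfer (geo9Y (f i)) δF α (F.Λf δF α) (fun a => (geo9Y (f i)).len a ^ 2) ∧
        ScaleTransfer (geo9Y (f i)) δF α (F.Λf δF α) (fun a => ((geo9Y (f i)).len a ^ 4)⁻¹) := by
    intro α hα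
    obtain ⟨t1, t2, -, -, t4, -⟩ := F.hST_of i hδF0 hδFc hMF α hα
    exact ⟨t1, t2, t4⟩
  have hTCF : ∀ α : ℝ, 9 / 5000 ≤ α → ∀ a a' : (geo9Y (f i)).Site,
      Real.exp (-(α * δF * (geo9Y (f i)).dist a a')) * wcY (f i).toKIdx a' ≤ (fun _ : ℝ => ΛC0) α * wcY (f i).toKIdx a := by
    intro α hα a a'
    have hκlo : 0 < 9 / 5000 * δF := by positivity
    have hκ : 9 / 5000 * δF ≤ α * δF := mul_le_mul_of_nonneg_right hα hδF0.le
    exact transfer_wcY (f i) (ιB i) (hι i) hκlo hκ hMCle a a'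
  -- the structured ℓ² readings of Q′, Q′*, F′, F′* (§1) at the base and at the product
  obtain ⟨hQc, hQc₁, hQcs, hQcs₁, hFc2, hFcs2⟩ := l2ReadingsQ_pairAt G (f i) (par i) b (ιB i) (Rr := F.Rr i) (Hp := F.Hp i) (hι i) hG1
    (hsym i) hM₂ hrepr hCq hR.2 hα₁.le hα1 (hC37 i α₁ V aa hC1).2
  have eQc : QcC (f i).toKIdx (par i) b (.base V) = F.Qc i U := by
    show _ = QcC (f i).toKIdx (parSelC G (f i).toKIdx (par i) (.base V)) b (.base V); rw [hsel]
  have eQc1 : QcC (f i).toKIdx (par i) b (.prod V aa) = F.Qc i ((codingYx P G (f i) (C37 i) (C38 i)).bg.mul U' U) := by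
    show _ = QcC (f i).toKIdx (parSelC G (f i).toKIdx (par i) (.prod V aa)) b (.prod V aa); rw [hselp]
  have eQcs : QcsC (f i).toKIdx (par i) b (.base V) = F.Qcs i U := by
    show _ = QcsC (f i).toKIdx (parSelC G (f i).toKIdx (par i) (.base V)) b (.base V); rw [hsel]
  have eQcs1 : QcsC (f i).toKIdx (par i) b (.prod V aa) = F.Qcs i ((codingYx P G (f i) (C37 i) (C38 i)).bg.mul U' U) := by
    show _ = QcsC (f i).toKIdx (parSelC G (f i).toKIdx (par i) (.prod V aa)) b (.prod V aa); rw [hselp]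
  rw [eQc] at hQc
  rw [eQc1] at hQc₁
  rw [eQcs] at hQcs
  rw [eQcs1] at hQcs₁
  rw [eQc1, eQc] at hFc2
  rw [eQcs1, eQcs] at hFcs2
  -- ★ the four (3.68) entries of F(A), C⁻¹ on the block carrier
  have h68 := ineq368_l2_FP (R := F.Rr i) (H := F.Hp i) b (F.T i) (F.coord i U) (F.blk i) (F.blkP i) (F.d261 δF) ((((geo9Y (f i)).eta : ℂ))⁻¹) δF BG ΘV ΘW
    κc κc θc θc BC BC' α₁ (F.Λf δF) (fun _ => ΛC0) (wcY (f i).toKIdx) (wsY (f i).toKIdx) hδF0 hBG0 hΘV0 hΘW0 hκc0 hκc0 hθc0 hθc0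
    hBC0 hBC'0 hα₁.le (fun α hα => F.Λf_one_le δF α hδF0 hα) (fun α => hΛC00) (wcY_nonneg (f i).toKIdx) (wsY_nonneg (f i).toKIdx)
    (fun a => (wsY_mul_wcY (f i).toKIdx a).le) (F.dist_nonneg i) (F.dist_comm i) (F.triangle i) (F.len_pos i) h261F hSTF hTCF h365 h365'
    g0m g1m hGt0 hGt1 hGt2 hVG hGV hQc hQc₁ hQcs hQcs₁ hFc2 hFcs2 h348F h348F' (F.reg_cinv i α₀ U hM hα₀ hMa hU) hT1
  obtain ⟨hPp, hDPp, hPpDs, hDPpDs⟩ := h68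
  -- ★ the three (3.49) entries of R₀(U) from the readings
  obtain ⟨f1, f2, -, -, f4, -⟩ := F.hST_of i hδF0 hδFc hMF (1 / 100) (by norm_num)
  have hr49 : 21 / 25 * δF + (2 * (1 / 100) + 1 / 100) * δF ≤ (1 - 1 / 100) * δF := by nlinarith only [hδF0]
  have hδC : (1 - 1 / 100) * δF ≤ (1 - 1 / 100) * δF := le_rfl
  have lowF := fun (A : ℝ) (w : (geo9Y (f i)).Site → ℝ) (hA : 0 ≤ A) (hw : ∀ a, 0 ≤ w a) {T₀ : Module.End ℝ (SiteY (f i).toKIdx × ι → ℝ)}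
      (hT : HasL2Majorant (g := toB6 (geo9Y (f i)) (F.Rr i) (F.Hp i)) (fun p : SiteY (f i).toKIdx × ι => F.blk i p.1) T₀
        (fun a a' => A * w a * Real.exp (-(δF * (geo9Y (f i)).dist a a')))) =>
    low A w hA hw (show (1 - 1 / 100) * δF ≤ δF by nlinarith only [hδF0]) hT
  have h49 := ineq349_l2Hom_of_readingsP (R := F.Rr i) (H := F.Hp i) b (F.T i) (F.coord i U) (F.blk i) (F.blkP i) (F.d261 δF)
    ((((geo9Y (f i)).eta : ℂ))⁻¹) δF ((1 - 1 / 100) * δF) (1 / 100) (1 / 100) (21 / 25 * δF) ΛF BG δF (1 / 100) ΛC0 κc κc BC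
    (wcY (f i).toKIdx) (wsY (f i).toKIdx)
    hBG0 hΛF1 (by positivity) (by norm_num) (by norm_num) hδF0.le hr49 hκc0 hκc0 hBC0 hΛC00 (wsY_nonneg (f i).toKIdx)
    (fun a => (wsY_mul_wcY (f i).toKIdx a).le) hδC
    (F.dist_nonneg i) (F.triangle i) (F.len_pos i) (h261F (1 / 100) (by norm_num) (by norm_num)) f1 f2 f4 (hTCF (1 / 100) (by norm_num))
    (lowF BG _ hBG0 hw2 g0m) (fun μ => lowF BG _ hBG0 hw1 (g1m μ)) (fun ν => lowF BG _ hBG0 hw1 (g2m ν)) hQc hQcs h348F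
  obtain ⟨hP, hDP, hPDs⟩ := h49
  -- ★ (3.77) for the concrete P₁(A)
  obtain ⟨-, -, f1i, -, -, -⟩ := F.hST_of i hδF0 hδFc hMF (1 / 100) (by norm_num)
  have hr77 : 4 / 5 * δF + 2 * ((1 / 100 + 1 / 100) * δF) ≤ 21 / 25 * δF := by nlinarith only [hδF0]
  have h77 := ineq377_l2_concreteE (Rr := F.Rr i) (H := F.Hp i) b (F.T i) (F.coord i U) (F.blk i) (F.d261 δF) δF (21 / 25 * δF) (1 / 100) (1 / 100)
    (4 / 5 * δF) ΛF KP KPp α₁ F.d₀ F.M₂ hKP0 hKPp0 hα₁.le hΛF1 (by positivity) (by norm_num) (by norm_num) hδF0.le (by positivity) F.M₂_nonneg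
    hr77 (F.dist_nonneg i) (F.triangle i) (F.len_pos i) (h261F (1 / 100) (by norm_num) (by norm_num)) f1i F.hrepr (F.eta_pos i) (F.unitary i U)
    (F.expA i U U') hA (fun ν x => hAτ ν ν x) hsmall4 (F.stencilF i) (F.stencilB i) hP hDP hPDs hPp hDPp hPpDs hDPpDs
  -- the word IS `pOneConc` at the frame's letters; the constant at α₁ ≦ 1
  refine hasL2Majorant_mono (g := toB6 (geo9Y (f i)) (F.Rr i) (F.Hp i)) _ h77 fun a a' => ?_
  have hk : kappa377 cE KP KPp ΛF cFL α₁ ≤ kappa377 cE KP KPp ΛF cFL 1 :=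
    kappa377_le_one hcE0 hKP0 hKPp0 (zero_le_one.trans hΛF1) hcFL0 hα₁.le hα1
  have h0 : 0 ≤ α₁ * ((geo9Y (f i)).len a ^ 2)⁻¹ * Real.exp (-(4 / 5 * δF * (geo9Y (f i)).dist a a')) := by
    have := inv_nonneg.mpr (hw2 a); positivity
  calc _ = kappa377 cE KP KPp ΛF cFL α₁ * (α₁ * ((geo9Y (f i)).len a ^ 2)⁻¹ * Real.exp (-(4 / 5 * δF * (geo9Y (f i)).dist a a'))) := by
        rw [hcE, hΛF, hcFL]; ring
    _ ≤ κ₇ * (α₁ * ((geo9Y (f i)).len a ^ 2)⁻¹ * Real.exp (-(4 / 5 * δF * (geo9Y (f i)).dist a a'))) := mul_le_mul_of_nonneg_right hk h0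
    _ = _ := by ring

end Read377

end Literature.MathematicalPhysics.QuantumFieldTheory.Balaban1983to89.B9SectBL2GFrameSelQY

end
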